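import Literature.NumberTheory.EllipticCurves.EichlerShimuraRealInjectivityProofs
import Literature.NumberTheory.EllipticCurves.ModularSymbolsManin
import Literature.NumberTheory.EllipticCurves.ModularFormsGamma0DimensionIneqProofs
import Mathlib.Data.Nat.Choose.Sum
import HarnessLib

/-!
# Weight-`k` M-symbols for `Γ₀(N)`: Manin's presentation and the rank half of Eichler–Shimura

For even `n` (weight `k = n + 2`) this file bounds the rank of the **cuspidal period lattice**
`C ⊆ S_k(Γ₀(N))^∨` (`cuspidalLatticeK`: the integral combinations `∑ a_{γ,q} λ_{γ,q}` of the period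
functionals `λ_{γ,q} : f ↦ ∫_{z₀}^{γz₀} f(z) det((z,1), γq)ⁿ dz` of `EichlerShimuraPeriods` whose
total boundary `∑ a_{γ,q} (q₁ⁿ - (γq)₁ⁿ)` vanishes):

* `finrank_span_cuspidalLatticeK_le` : `dim_ℚ ℚC ≤ 2 dim_ℂ S_k(Γ₀(N))` (`n` even, `n ≠ 0`).

This is the inequality half of `rank H¹_par(Γ₀(N), Symⁿ ℤ²) = 2 dim S_k` (Shimura 1971, Thm. 8.4
with Prop. 8.6), obtained here without cohomology through the weight-`k` **M-symbols** of
Manin (1972, §1.6–1.9) and Merel (1994, Thm. 2): with `X = SL(2, ℤ)/Γ₀(N)` (`μ = [SL₂(ℤ) : Γ₀(N)]`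
cosets) and `𝕄 = ℚ^X ⊗ ℚⁿ⁺¹`,

1. (§1) the twists `σ_S`, `σ_T`, `σ_U = σ_T σ_S` of `Symⁿ` in moment coordinates
   (`momPoly (σ y) = momPoly y ∘ g⁻¹`), `σ_S² = 1`, `σ_U³ = 1`, and their traces
   `tr σ_S = (-1)^{n/2}`, `tr σ_U = tr σ_U² = A(n) = ∑ⱼ (-1)ʲ C(n-j, j) = -ε₆(n+2)` (`altFib`);
2. (§2) the moment M-symbol `μ(g) = a_{f|g}(i) - σ_S a_{f|gS}(i)` of `g ∈ SL(2, ℤ)`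
   (`msymbMoment`), with `momPoly μ(g) p = c_f(g)(p) - c_f(gS)(S⁻¹p)`, left `Γ₀(N)`-invariance, and
   the two- and three-term relations `μ(g) + σ_S μ(gS) = 0`,
   `μ(g) + σ_U μ(gU) + σ_U² μ(gU²) = 0` (`U = TS`; from the cocycle relation and
   `periodFn_mul_of_apply_one_zero`);
3. (§3–§5) the M-symbol map `Ψ : 𝕄 → S_k^∨`, the boundary `δ : 𝕄 → ℚ^{cusps}`
   (`e_x ⊗ v ↦ vₙ[x⁻¹∞] - v₀[x⁻¹0]`), the relation module `Rel = im(1 + opS) + im(1 + opU + opU²)`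
   inside `ker Ψ ∩ ker δ`, the trace count
   `dim Rel = (μ(n+1) + ν₂ tr σ_S)/2 + (μ(n+1) + 2ν₃ A(n))/3` (the two summands meet trivially:
   `Symⁿ` has no `Γ₀(N)`-invariants for `n ≥ 1`, `fixedOpS_inf_fixedOpU_eq_bot`), `δ` onto, whence
   `6 dim Ψ(ker δ) ≤ (k-1)μ + 3ν₂ε₄(k) + 4ν₃ε₆(k) - 6ν_∞ ≤ 12 dim S_k` by the dimension inequality
   `le_twelve_mul_finrank_cuspForm_gamma0_of_even` (`finrank_map_ker_bdryKMap_le`);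
4. (§6) Manin's continued-fraction trick in weight `k` (`exists_chainK`): every `λ_{g,q}`,
   `g ∈ SL(2, ℤ)`, is `Ψ` of an integral chain with boundary `q₁ⁿ[g∞] - (gq)₁ⁿ[∞]`;
5. (§7) hence `ℚC ⊆ Ψ(ker δ)` and the rank bound.

Together with the real injectivity of the period map (`EichlerShimuraRealInjectivityProofs`) and
the Hecke equivariance of the `λ_{γ,q}` (`EichlerShimuraPeriods.dualMap_heckeT_periodFunctionalK`)
this yields a Hecke-stable full lattice in `S_k(Γ₀(N))_ℝ` (Shimura 1971, Thm. 3.48 / (3.5.20)),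
assembled in `NewformsCoeffFieldLatticeHigherWeightProofs`.

## References

* [Shimura1971] G. Shimura, *Introduction to the Arithmetic Theory of Automorphic Functions*,
  Princeton Univ. Press, 1971 — Ch. 8, §8.2 (parabolic cohomology, Thm. 8.4), Prop. 8.6.
* [Manin1972] Ju. I. Manin, *Parabolic points and zeta functions of modular curves*,
  Izv. Akad. Nauk SSSR Ser. Mat. 36 (1972), 19–66 — §1.6–1.9 (Thm. 1.6, Thm. 1.9).
* [Merel1994] L. Merel, *Universal Fourier expansions of modular forms*, in: On Artin's conjecture
  for odd 2-dimensional representations, LNM 1585 (1994), 59–94 — Thm. 2, Prop. 4, Prop. 8.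
* [Stein2007] W. Stein, *Modular Forms, a Computational Approach*, AMS GSM 79, 2007 — Ch. 8
  (Thm. 8.4, Prop. 8.17).
-/

noncomputable section

open scoped MatrixGroups ModularForm Topology Manifold ComplexConjugate

open CongruenceSubgroup Complex MeasureTheory Set Filter Function Matrix.SpecialLinearGroup
  ModularGroup
open UpperHalfPlane hiding I

namespace Literature.NumberTheory.EllipticCurves.ModularForms

/-! ### §1. The twists `σ_S`, `σ_T`, `σ_U = σ_T σ_S` of `Symⁿ` in moment coordinates -/

section Twists

variable {K : Type*} [Field K] [CharZero K] (n : ℕ)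

/-- The twist by `S`: `(σ_S y)ⱼ = (-1)ʲ y_{n-j}`, so that `momPoly (σ_S y) = momPoly y ∘ S⁻¹`
(`S⁻¹(u, v) = (v, -u)`). [folklore] -/
def twistS : Matrix (Fin (n + 1)) (Fin (n + 1)) K :=
  Matrix.of fun j i ↦ if i = Fin.rev j then (-1) ^ (j : ℕ) else 0

/-- The twist by `T`: the Pascal matrix `(σ_T y)ⱼ = ∑_{i ≤ j} C(j,i) yᵢ`, so that
`momPoly (σ_T y) = momPoly y ∘ T⁻¹` (`T⁻¹(u, v) = (u - v, v)`). [folklore] -/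
def twistP : Matrix (Fin (n + 1)) (Fin (n + 1)) K :=
  Matrix.of fun j i ↦ if (i : ℕ) ≤ j then (((j : ℕ).choose i : ℕ) : K) else 0

/-- The twist by `U = TS` (of order `3` in `PSL(2, ℤ)`): `σ_U = σ_T σ_S`. [folklore] -/
def twistU : Matrix (Fin (n + 1)) (Fin (n + 1)) K := twistP n * twistS n

variable {n}

/-- `(σ_S y)ⱼ = (-1)ʲ y_{n-j}`. [folklore] -/
theorem twistS_mulVec (y : Fin (n + 1) → K) (j : Fin (n + 1)) :
    (twistS n).mulVec y j = (-1) ^ (j : ℕ) * y (Fin.rev j) := by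
  simp only [twistS, Matrix.mulVec, dotProduct, Matrix.of_apply]
  rw [Finset.sum_eq_single (Fin.rev j)]
  · simp
  · intro i _ hi
    simp [hi]
  · simp

omit [CharZero K] in
/-- `(σ_T y)ⱼ = ∑ᵢ [i ≤ j] C(j,i) yᵢ`. [folklore] -/
theorem twistP_mulVec (y : Fin (n + 1) → K) (j : Fin (n + 1)) :
    (twistP n).mulVec y j =
      ∑ i : Fin (n + 1), (if (i : ℕ) ≤ j then (((j : ℕ).choose i : ℕ) : K) else 0) * y i := by
  simp [twistP, Matrix.mulVec, dotProduct, Matrix.of_apply]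

/-- `σ_S² = 1` (even `n`). [folklore] -/
theorem twistS_mulVec_twistS_mulVec (hn : Even n) (y : Fin (n + 1) → K) :
    (twistS n).mulVec ((twistS n).mulVec y) = y := by
  funext j
  rw [twistS_mulVec, twistS_mulVec, Fin.rev_rev, val_rev_eq, neg_one_pow_sub_of_even hn (fin_le j),
    ← mul_assoc, ← pow_add, ← two_mul, pow_mul]
  simp

/-- `σ_S² = 1` as matrices (even `n`). [folklore] -/
theorem twistS_mul_twistS (hn : Even n) : twistS n * twistS n = (1 : Matrix (Fin (n + 1)) (Fin (n + 1)) K) := by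
  refine Matrix.ext_iff_mulVec.mpr fun y ↦ ?_
  rw [← Matrix.mulVec_mulVec, twistS_mulVec_twistS_mulVec hn, Matrix.one_mulVec]

/-- **`momPoly (σ_S y) (u, v) = momPoly y (v, -u)`** (`= momPoly y ∘ S⁻¹`). [folklore] -/
theorem momPoly_twistS_mulVec (y : Fin (n + 1) → K) (p : Fin 2 → K) :
    momPoly n ((twistS n).mulVec y) p = momPoly n y ![p 1, -p 0] := by
  rw [momPoly_apply, momPoly_apply]
  refine Fintype.sum_equiv Fin.revPerm _ _ fun j ↦ ?_
  have hj := fin_le j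
  simp only [twistS_mulVec, Fin.revPerm_apply, val_rev_eq, Matrix.cons_val_one,
    Matrix.cons_val_zero]
  rw [Nat.choose_symm hj, Nat.sub_sub_self hj, neg_pow (p 1)]
  ring

omit [CharZero K] in
/-- `σ_T e(z) = e(z + 1)` (binomial theorem). [folklore] -/
theorem twistP_mulVec_powVec (z : K) : (twistP n).mulVec (powVec n z) = powVec n (z + 1) := by
  funext j
  rw [twistP_mulVec, powVec_apply, add_pow]
  simp only [powVec_apply, one_pow, mul_one]
  rw [Finset.sum_range, Fin.sum_univ_eq_sum_range (fun i ↦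
    (if i ≤ (j : ℕ) then (((j : ℕ).choose i : ℕ) : K) else 0) * z ^ i) (n + 1)]
  have hj := fin_le j
  rw [← Finset.sum_range_add_sum_Ico _ (Nat.succ_le_succ hj)]
  rw [Finset.sum_eq_zero (s := Finset.Ico (j + 1 : ℕ) (n + 1)) (fun i hi ↦ by
    rw [Finset.mem_Ico] at hi
    rw [if_neg (by omega), zero_mul]), add_zero,
    ← Fin.sum_univ_eq_sum_range (fun i ↦ (if i ≤ (j : ℕ) then (((j : ℕ).choose i : ℕ) : K) else 0) * z ^ i)]
  refine Finset.sum_congr rfl fun i _ ↦ ?_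
  rw [if_pos (Nat.lt_succ_iff.mp i.isLt), mul_comm]

/-- **`momPoly (σ_T y) (u, v) = momPoly y (u - v, v)`** (`= momPoly y ∘ T⁻¹`): both sides are
linear in `y` and agree on the basis of pure powers (`σ_T e(z) = e(z+1)` and
`e(z) ∘ T⁻¹ = e(z + 1)`). [folklore] -/
theorem momPoly_twistP_mulVec (y : Fin (n + 1) → K) (p : Fin 2 → K) :
    momPoly n ((twistP n).mulVec y) p = momPoly n y ![p 0 - p 1, p 1] := by
  obtain ⟨c, rfl⟩ := exists_eq_sum_smul_powVec (K := K) (n := n) (w := fun l : Fin (n + 1) ↦ (l : K))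
    (fun a b hab ↦ by
      have h' : ((a : ℕ) : K) = (b : ℕ) := hab
      exact Fin.ext (by exact_mod_cast h')) y
  rw [Matrix.mulVec_sum, map_sum, map_sum]
  simp only [Finset.sum_apply]
  refine Finset.sum_congr rfl fun l _ ↦ ?_
  rw [Matrix.mulVec_smul, map_smul, map_smul, Pi.smul_apply, Pi.smul_apply, twistP_mulVec_powVec]
  congr 1
  set M : Matrix (Fin 2) (Fin 2) K := !![1, -1; 0, 1] with hM
  have hp : (![p 0 - p 1, p 1] : Fin 2 → K) = M.mulVec p := by
    funext i
    fin_cases i <;> simp [hM, Matrix.mulVec, dotProduct, Fin.sum_univ_two, sub_eq_add_neg]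
  rw [hp, momPoly_powVec_mulVec M (z := (l : K)) (z' := (l : K) + 1) (by simp [hM]) p]
  simp [hM]

/-- **`momPoly (σ_U y) (u, v) = momPoly y (v, v - u)`** (`= momPoly y ∘ U⁻¹`, `U = TS`). [folklore] -/
theorem momPoly_twistU_mulVec (y : Fin (n + 1) → K) (p : Fin 2 → K) :
    momPoly n ((twistU n).mulVec y) p = momPoly n y ![p 1, p 1 - p 0] := by
  rw [twistU, ← Matrix.mulVec_mulVec, momPoly_twistP_mulVec, momPoly_twistS_mulVec]
  have hv : (![(![p 0 - p 1, p 1] : Fin 2 → K) 1, -(![p 0 - p 1, p 1] : Fin 2 → K) 0] : Fin 2 → K) =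
      ![p 1, p 1 - p 0] := by
    funext i
    fin_cases i <;> simp
  rw [hv]

/-- `σ_U³ = 1` (even `n`): `U⁻³ = -1` acts trivially in even degree. [folklore] -/
theorem twistU_pow_three (hn : Even n) : twistU n ^ 3 = (1 : Matrix (Fin (n + 1)) (Fin (n + 1)) K) := by
  refine Matrix.ext_iff_mulVec.mpr fun y ↦ ?_
  rw [pow_three, ← Matrix.mulVec_mulVec, ← Matrix.mulVec_mulVec, Matrix.one_mulVec]
  refine eq_of_momPoly_eq hn fun p ↦ ?_
  set u : (Fin 2 → K) → (Fin 2 → K) := fun p ↦ ![p 1, p 1 - p 0] with hu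
  have hU : ∀ (y : Fin (n + 1) → K) (p : Fin 2 → K),
      momPoly n ((twistU n).mulVec y) p = momPoly n y (u p) := fun y p ↦ momPoly_twistU_mulVec y p
  have hu3 : u (u (u p)) = (-1 : K) • p := by
    funext i
    fin_cases i
    · simp [hu]
    · simp [hu]
      ring
  rw [hU, hU, hU, hu3, momPoly_smul_right, hn.neg_one_pow, one_mul]

/-- The columns of `σ_U` at the "cusp vectors": `σ_U δ₀ = δₙ`. [folklore] -/
theorem twistU_mulVec_single_zero (hn : Even n) :
    (twistU n).mulVec (Pi.single 0 (1 : K)) = Pi.single (Fin.last n) 1 := by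
  refine eq_of_momPoly_eq hn fun p ↦ ?_
  rw [momPoly_twistU_mulVec, momPoly_apply, momPoly_apply, Finset.sum_eq_single 0
    (fun j _ hj ↦ by simp [hj]) (by simp), Finset.sum_eq_single (Fin.last n)
    (fun j _ hj ↦ by simp [hj]) (by simp)]
  simp [hn.neg_pow]

/-- `σ_U δₙ = 𝟙` (the all-ones vector). [folklore] -/
theorem twistU_mulVec_single_last (hn : Even n) :
    (twistU n).mulVec (Pi.single (Fin.last n) (1 : K)) = fun _ ↦ 1 := by
  refine eq_of_momPoly_eq hn fun p ↦ ?_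
  rw [momPoly_twistU_mulVec, momPoly_apply, momPoly_apply, Finset.sum_eq_single (Fin.last n)
    (fun j _ hj ↦ by simp [hj]) (by simp)]
  simp only [Pi.single_eq_same, mul_one, Matrix.cons_val_one, Fin.val_last,
    Nat.sub_self, pow_zero, Matrix.cons_val_zero]
  rw [sub_eq_add_neg, add_pow, Finset.sum_range]
  simp only [Nat.choose_self, Nat.cast_one, one_mul]
  refine Finset.sum_congr rfl fun j _ ↦ ?_
  ring

/-- `σ_U 𝟙 = δ₀`. [folklore] -/
theorem twistU_mulVec_one (hn : Even n) :
    (twistU n).mulVec (fun _ ↦ (1 : K)) = Pi.single 0 1 := by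
  have h3 := twistU_pow_three (K := K) hn
  have : (twistU n ^ 3).mulVec (Pi.single 0 (1 : K)) = Pi.single 0 1 := by rw [h3, Matrix.one_mulVec]
  rw [pow_three, ← Matrix.mulVec_mulVec, ← Matrix.mulVec_mulVec, twistU_mulVec_single_zero hn,
    twistU_mulVec_single_last hn] at this
  exact this

/-- `trace σ_S = (-1)^{n/2}` (only the middle index is fixed by `j ↦ n - j`). [folklore] -/
theorem trace_twistS (hn : Even n) : Matrix.trace (twistS (K := K) n) = (-1) ^ (n / 2) := by
  have hmid : n / 2 < n + 1 := by omega
  rw [Matrix.trace]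
  simp only [Matrix.diag, twistS, Matrix.of_apply]
  rw [Finset.sum_eq_single ⟨n / 2, hmid⟩]
  · have : (⟨n / 2, hmid⟩ : Fin (n + 1)) = Fin.rev ⟨n / 2, hmid⟩ := by
      apply Fin.ext
      rw [val_rev_eq]
      obtain ⟨m, hm⟩ := hn
      simp only
      omega
    rw [if_pos this]
  · intro j _ hj
    rw [if_neg]
    intro h
    apply hj
    apply Fin.ext
    have := congrArg Fin.val h
    rw [val_rev_eq] at this
    simp only
    omega
  · simp

/-- The alternating diagonal sum `A(n) = ∑ᵢ (-1)ⁱ C(n - i, i)` (the trace of `σ_U` on `Symⁿ`;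
`1, 1, 0, -1, -1, 0` periodically). [folklore] -/
def altFib (n : ℕ) : ℤ := ∑ i ∈ Finset.range (n + 1), (-1) ^ i * ((n - i).choose i : ℤ)

/-- The recurrence `A(n + 2) = A(n + 1) - A(n)` (Pascal). [folklore] -/
theorem altFib_add_two (n : ℕ) : altFib (n + 2) = altFib (n + 1) - altFib n := by
  have h2 : altFib (n + 2) =
      1 + ∑ i ∈ Finset.range (n + 1), (-1 : ℤ) ^ (i + 1) * ((n + 1 - i).choose (i + 1) : ℤ) := by
    unfold altFib
    rw [Finset.sum_range_succ' _ (n + 2), Finset.sum_range_succ _ (n + 1)]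
    have ht : ((n + 2 - (n + 1 + 1)).choose (n + 1 + 1) : ℤ) = 0 := by
      rw [show n + 2 - (n + 1 + 1) = 0 by omega, Nat.choose_eq_zero_of_lt (by omega)]
      simp
    rw [ht, mul_zero, add_zero, add_comm]
    congr 1
    refine Finset.sum_congr rfl fun i hi ↦ ?_
    rw [Finset.mem_range] at hi
    rw [show n + 2 - (i + 1) = n + 1 - i by omega]
  have h1 : altFib (n + 1) =
      1 + ∑ i ∈ Finset.range (n + 1), (-1 : ℤ) ^ (i + 1) * ((n - i).choose (i + 1) : ℤ) := by
    unfold altFib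
    rw [Finset.sum_range_succ' _ (n + 1), add_comm]
    congr 1
    refine Finset.sum_congr rfl fun i _ ↦ ?_
    rw [show n + 1 - (i + 1) = n - i by omega]
  have hP : ∀ i ∈ Finset.range (n + 1), ((n + 1 - i).choose (i + 1) : ℤ) =
      ((n - i).choose i : ℤ) + ((n - i).choose (i + 1) : ℤ) := by
    intro i hi
    rw [Finset.mem_range] at hi
    rw [show n + 1 - i = (n - i) + 1 by omega, Nat.choose_succ_succ]
    push_cast
    ring
  rw [h2, h1, altFib, Finset.sum_congr rfl fun i hi ↦ by rw [hP i hi]]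
  simp only [mul_add, Finset.sum_add_distrib]
  have e1 : ∑ i ∈ Finset.range (n + 1), (-1 : ℤ) ^ (i + 1) * ((n - i).choose i : ℤ) =
      -∑ i ∈ Finset.range (n + 1), (-1 : ℤ) ^ i * ((n - i).choose i : ℤ) := by
    rw [← Finset.sum_neg_distrib]
    refine Finset.sum_congr rfl fun i _ ↦ ?_
    ring
  rw [e1]
  ring

/-- `A` has period `6`. [folklore] -/
theorem altFib_add_six (n : ℕ) : altFib (n + 6) = altFib n := by
  have h := fun m ↦ altFib_add_two m
  have h3 : ∀ m, altFib (m + 3) = -altFib m := fun m ↦ by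
    rw [show m + 3 = (m + 1) + 2 by omega, h, h]
    ring
  rw [show n + 6 = (n + 3) + 3 by omega, h3, h3, neg_neg]

/-- `A(0) = 1`, `A(2) = 0`, `A(4) = -1`. [folklore] -/
theorem altFib_values : altFib 0 = 1 ∧ altFib 2 = 0 ∧ altFib 4 = -1 := by
  refine ⟨?_, ?_, ?_⟩ <;> decide

/-- **`A(n) = -ε₆(n + 2)` for even `n`** (`ε₆` of `ModularFormsGamma0Dimension`: `1, -1, 0` for
`k ≡ 0, 2, 4 (mod 6)`). [folklore] -/
theorem altFib_eq_neg_eps6 (hn : Even n) : altFib n = -eps6 ((n : ℤ) + 2) := by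
  have key : ∀ q r : ℕ, r < 6 → altFib (6 * q + r) = altFib r := by
    intro q r _
    induction q with
    | zero => simp
    | succ q ih => rw [show 6 * (q + 1) + r = (6 * q + r) + 6 by ring, altFib_add_six, ih]
  obtain ⟨a1, a2, a3⟩ := altFib_values
  have hr : n % 6 < 6 := Nat.mod_lt _ (by norm_num)
  have hn6 : n = 6 * (n / 6) + n % 6 := (Nat.div_add_mod n 6).symm
  rw [hn6, key _ _ hr]
  obtain ⟨m, hm⟩ := hn
  have hcases : n % 6 = 0 ∨ n % 6 = 2 ∨ n % 6 = 4 := by omega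
  unfold eps6
  rcases hcases with h | h | h <;> rw [h] <;> simp only [a1, a2, a3] <;> split_ifs <;> push_cast at * <;>
    omega

/-- **`trace σ_U = A(n)`**: the diagonal of `σ_T σ_S` is `(-1)^{n-j} C(j, n-j)`. [folklore] -/
theorem trace_twistU : Matrix.trace (twistU (K := K) n) = (altFib n : K) := by
  rw [Matrix.trace, altFib]
  push_cast
  rw [Finset.sum_range]
  refine Fintype.sum_equiv Fin.revPerm _ _ fun j ↦ ?_
  have hj := fin_le j
  simp only [Matrix.diag, twistU, Matrix.mul_apply, twistP, twistS, Matrix.of_apply,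
    Fin.revPerm_apply, val_rev_eq]
  rw [Finset.sum_eq_single (Fin.rev j) (fun x _ hx ↦ ?_) (by simp)]
  · simp only [Fin.rev_rev, if_true, val_rev_eq]
    rw [Nat.sub_sub_self hj]
    by_cases h : n - (j : ℕ) ≤ j
    · rw [if_pos h]
      ring
    · rw [if_neg h, Nat.choose_eq_zero_of_lt (by omega)]
      simp
  · rw [if_neg (show ¬ (j = Fin.rev x) from fun h ↦ hx (by rw [h, Fin.rev_rev])), mul_zero]

/-- **`σ_Tᵀ`-invariant vectors are multiples of `δ₀`**: pairing with `e(z)` gives a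
polynomial `φ(z) = ∑ vⱼ zʲ` with `φ(z + 1) = φ(z)`, hence constant. [folklore] -/
theorem eq_smul_single_of_twistP_transpose_mulVec {v : Fin (n + 1) → K}
    (hv : (twistP n).transpose.mulVec v = v) : v = v 0 • Pi.single 0 1 := by
  -- `∑ vⱼ (z+1)ʲ = ∑ vⱼ zʲ`
  have hper : ∀ z : K, dotProduct v (powVec n (z + 1)) = dotProduct v (powVec n z) := by
    intro z
    rw [← twistP_mulVec_powVec, Matrix.dotProduct_mulVec, ← Matrix.mulVec_transpose, hv]
  set P : Polynomial K := ∑ j : Fin (n + 1), Polynomial.C (v j) * Polynomial.X ^ (j : ℕ) with hP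
  have hPe : ∀ z : K, P.eval z = dotProduct v (powVec n z) := fun z ↦ by
    simp [hP, Polynomial.eval_finsetSum, dotProduct]
  have hPer : ∀ z : K, (P - Polynomial.C (P.eval 0)).eval z = 0 → (P - Polynomial.C (P.eval 0)).eval (z + 1) = 0 := by
    intro z hz
    rw [Polynomial.eval_sub, Polynomial.eval_C, hPe, hper, ← hPe, ← Polynomial.eval_C (a := P.eval 0) (x := z),
      ← Polynomial.eval_sub]
    exact hz
  have hnat : ∀ m : ℕ, (P - Polynomial.C (P.eval 0)).eval (m : K) = 0 := by
    intro m
    induction m with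
    | zero => simp
    | succ m ih => have := hPer m ih; push_cast; exact this
  have hzero : P - Polynomial.C (P.eval 0) = 0 :=
    Polynomial.eq_zero_of_infinite_isRoot _
      ((Set.infinite_range_of_injective Nat.cast_injective).mono (by
        rintro _ ⟨m, rfl⟩
        exact hnat m))
  rw [sub_eq_zero] at hzero
  funext j
  have hcoeff := congrArg (fun Q ↦ Polynomial.coeff Q j) hzero
  simp only [hP, Polynomial.finsetSum_coeff, Polynomial.coeff_C_mul_X_pow, Polynomial.coeff_C] at hcoeff
  rw [Finset.sum_eq_single j (fun i _ hij ↦ by rw [if_neg (fun h ↦ hij (Fin.ext h.symm))]) (by simp),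
    if_pos rfl] at hcoeff
  by_cases hj : j = 0
  · subst hj; simp
  · have : (j : ℕ) ≠ 0 := fun h ↦ hj (Fin.ext h)
    rw [if_neg this] at hcoeff
    simp [hcoeff, hj]

/-- `σ_Tᴺ δ₀ = e(N)` (iterate `σ_T e(z) = e(z+1)` from `e(0) = δ₀`). [folklore] -/
theorem twistP_pow_mulVec_single_zero (m : ℕ) :
    (twistP n ^ m).mulVec (Pi.single 0 (1 : K)) = powVec n (m : K) := by
  have h0 : (Pi.single 0 (1 : K) : Fin (n + 1) → K) = powVec n 0 := by
    funext j
    by_cases hj : j = 0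
    · subst hj; simp
    · have : (j : ℕ) ≠ 0 := fun h ↦ hj (Fin.ext h)
      simp [hj, zero_pow this]
  rw [h0]
  induction m with
  | zero => simp
  | succ m ih => rw [pow_succ', ← Matrix.mulVec_mulVec, ih, twistP_mulVec_powVec]; push_cast; rfl

end Twists

/-! ### §2. The moment functionals of an M-symbol: `μ(g) = a_{f|g}(i) - σ_S a_{f|gS}(i)` -/

section Moments

variable {N : ℕ} [NeZero N] (n : ℕ)

omit [NeZero N] in
/-- **Slashing by `-g` equals slashing by `g` in the even weight `n + 2`.** [folklore] -/
theorem slash_neg_eq_of_even (hn : Even n) (φ : ℍ → ℂ) (g : SL(2, ℤ)) :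
    φ ∣[(n + 2 : ℤ)] (-g) = φ ∣[(n + 2 : ℤ)] g := by
  funext τ
  rw [ModularForm.SL_slash_apply, ModularForm.SL_slash_apply, ModularGroup.SL_neg_smul,
    ModularGroup.denom_apply, ModularGroup.denom_apply]
  have e : ((((-g : SL(2, ℤ)) 1 0 : ℤ) : ℂ) * (τ : ℂ) + (((-g : SL(2, ℤ)) 1 1 : ℤ) : ℂ)) =
      -((((g 1 0 : ℤ)) : ℂ) * (τ : ℂ) + ((g 1 1 : ℤ) : ℂ)) := by
    simp only [Matrix.SpecialLinearGroup.coe_neg, Matrix.neg_apply, Int.cast_neg]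
    ring
  rw [e, show (n + 2 : ℤ) = ((n + 2 : ℕ) : ℤ) by push_cast; ring, zpow_neg, zpow_neg, zpow_natCast,
    zpow_natCast, (hn.add even_two).neg_pow]

/-- `∫_i^{i∞} (f|g)(z) zʲ dz` as a linear functional of `f` (the moment functional of
`EichlerShimuraPeriods` without its binomial factor). [folklore] -/
def slashMoment (g : SL(2, ℤ)) (j : ℕ) : Module.Dual ℂ (CuspForm (Gamma0 N) (n + 2)) where
  toFun f := powPrimitive j (⇑f ∣[(n + 2 : ℤ)] g) UpperHalfPlane.I
  map_add' f f' := by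
    have h1 : (⇑(f + f') : ℍ → ℂ) ∣[(n + 2 : ℤ)] g = ⇑f ∣[(n + 2 : ℤ)] g + ⇑f' ∣[(n + 2 : ℤ)] g := by
      rw [CuspForm.coe_add, SlashAction.add_slash]
    rw [h1, (isCuspFunction_slash f g).powPrimitive_add j (isCuspFunction_slash f' g)]
  map_smul' c f := by
    have h1 : (⇑(c • f) : ℍ → ℂ) ∣[(n + 2 : ℤ)] g = c • (⇑f ∣[(n + 2 : ℤ)] g) := by
      rw [CuspForm.IsGLPos.coe_smul, ModularForm.SL_smul_slash]
    rw [h1, powPrimitive_const_smul]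
    simp

/-- Unfolding `slashMoment`. [folklore] -/
@[simp] theorem slashMoment_apply (g : SL(2, ℤ)) (j : ℕ) (f : CuspForm (Gamma0 N) (n + 2)) :
    slashMoment n g j f = powPrimitive j (⇑f ∣[(n + 2 : ℤ)] g) UpperHalfPlane.I := rfl

/-- **The moment functionals of the M-symbol `{g0, g∞}`**:
`μⱼ(g) = ∫_i^{i∞} (f|g) zʲ dz - (-1)ʲ ∫_i^{i∞} (f|gS) zⁿ⁻ʲ dz`, i.e. `μ(g) = a_{f|g}(i) - σ_S a_{f|gS}(i)`,
so that `momPoly μ(g)(f) = p ↦ c_f(g)(p) - c_f(gS)(S⁻¹p)`, the period of `f` over `{g0, g∞}`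
against `((zv - u) ∘ g)ⁿ` (`momPoly_msymbMoment`). [folklore] -/
def msymbMoment (g : SL(2, ℤ)) (j : Fin (n + 1)) : Module.Dual ℂ (CuspForm (Gamma0 N) (n + 2)) :=
  slashMoment n g j - ((-1 : ℂ) ^ (j : ℕ)) • slashMoment n (g * S) (n - j)

/-- The vector `(μⱼ(g)(f))ⱼ` is `a_{f|g}(i) - σ_S a_{f|gS}(i)`. [folklore] -/
theorem msymbMoment_vec (g : SL(2, ℤ)) (f : CuspForm (Gamma0 N) (n + 2)) :
    (fun j ↦ msymbMoment n g j f) =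
      momVec n (⇑f ∣[(n + 2 : ℤ)] g) UpperHalfPlane.I -
        (twistS n).mulVec (momVec n (⇑f ∣[(n + 2 : ℤ)] (g * S)) UpperHalfPlane.I) := by
  funext j
  simp [msymbMoment, twistS_mulVec, momVec]

omit [NeZero N] in
/-- `S (v, -u) = (u, v)`. [folklore] -/
theorem icmat_S_mulVec (p : Fin 2 → ℂ) : (icmat S).mulVec ![p 1, -p 0] = p := by
  funext i
  fin_cases i <;> simp [Matrix.mulVec, dotProduct, Fin.sum_univ_two, ModularGroup.coe_S]

/-- **`momPoly μ(g)(f) (u, v) = c_f(g)(u, v) - c_f(gS)(v, -u)`**: the transformation law at the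
base points `i` and `S⁻¹i = i`, where the terms `K_f(g i, g p) = K_f(gS i, gS S⁻¹p)` cancel. [folklore] -/
theorem momPoly_msymbMoment (g : SL(2, ℤ)) (f : CuspForm (Gamma0 N) (n + 2)) (p : Fin 2 → ℂ) :
    momPoly n (fun j ↦ msymbMoment n g j f) p =
      periodFn n f g p - periodFn n f (g * S) ![p 1, -p 0] := by
  rw [msymbMoment_vec, map_sub, Pi.sub_apply, momPoly_twistS_mulVec, ← eichlerKernel_eq_momPoly,
    ← eichlerKernel_eq_momPoly, periodFn_eq f g p UpperHalfPlane.I,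
    periodFn_eq f (g * S) _ UpperHalfPlane.I, mul_smul, S_smul_I, icmat_mul, ← Matrix.mulVec_mulVec,
    icmat_S_mulVec]
  ring

/-- **`Γ₀(N)`-invariance**: `μ(γg) = μ(g)` for `γ ∈ Γ₀(N)` (`f ∣ γg = f ∣ g`). [folklore] -/
theorem msymbMoment_gamma0_mul {γ : SL(2, ℤ)} (hγ : γ ∈ Gamma0 N) (g : SL(2, ℤ)) (j : Fin (n + 1)) :
    msymbMoment (N := N) n (γ * g) j = msymbMoment n g j := by
  have h1 : ∀ h : SL(2, ℤ), ∀ f : CuspForm (Gamma0 N) (n + 2),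
      (⇑f : ℍ → ℂ) ∣[(n + 2 : ℤ)] (γ * h) = ⇑f ∣[(n + 2 : ℤ)] h := fun h f ↦ by
    rw [SlashAction.slash_mul, slash_gamma0_eq_self f ⟨γ, hγ⟩]
  ext f
  simp [msymbMoment, h1, mul_assoc]

/-- **The two-term relation `μ(g) + σ_S μ(gS) = 0`** (even `n`; `f ∣ gSS = f ∣ (-g) = f ∣ g` and
`σ_S² = 1`), evaluated at `f`. [folklore] -/
theorem msymbMoment_two_term (hn : Even n) (g : SL(2, ℤ)) (f : CuspForm (Gamma0 N) (n + 2)) :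
    (fun j ↦ msymbMoment n g j f) + (twistS n).mulVec (fun j ↦ msymbMoment n (g * S) j f) = 0 := by
  rw [msymbMoment_vec, msymbMoment_vec, Matrix.mulVec_sub, twistS_mulVec_twistS_mulVec hn,
    show g * S * S = -g by rw [mul_assoc, S_mul_S_eq_neg_one, mul_neg_one], slash_neg_eq_of_even n hn]
  abel

/-- **The period of `hu` for `u` upper triangular: `c_f(hu)(p) = c_f(h)(up)`** (the kernel of
`(f|h)|u` is that of `f|h` moved by `u`, `eichlerKernel_slash_eq_of_apply_one_zero`) — so
`c_f(h)(p)` depends only on the cusp `h∞` and the vector `hp`. [folklore] -/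
theorem periodFn_mul_of_apply_one_zero (f : CuspForm (Gamma0 N) (n + 2)) (h u : SL(2, ℤ))
    (hu : u 1 0 = 0) (p : Fin 2 → ℂ) :
    periodFn n f (h * u) p = periodFn n f h ((icmat u).mulVec p) := by
  rw [periodFn_eq f (h * u) p UpperHalfPlane.I, periodFn_eq f h _ (u • UpperHalfPlane.I), mul_smul,
    icmat_mul, ← Matrix.mulVec_mulVec]
  congr 1
  have hφ : IsCuspFunction N (⇑f ∣[(n + 2 : ℤ)] h) := isCuspFunction_slash f h
  have hψ : IsCuspFunction N ((⇑f ∣[(n + 2 : ℤ)] h) ∣[(n + 2 : ℤ)] (u : GL (Fin 2) ℝ)) := by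
    rw [← ModularForm.SL_slash, ← SlashAction.slash_mul]
    exact isCuspFunction_slash f (h * u)
  have hg10 : (u : GL (Fin 2) ℝ) 1 0 = 0 := by
    simp [hu]
  have := hφ.eichlerKernel_slash_eq_of_apply_one_zero (n := n) (det_coe_pos u) hg10 hψ p
    UpperHalfPlane.I
  rw [cmat_coe, ← ModularForm.SL_slash, ← SlashAction.slash_mul] at this
  rw [this]
  rfl

omit [NeZero N] in
/-- `TSS = -T`. [folklore] -/
theorem TS_mul_S : T * S * S = -T := by rw [mul_assoc, S_mul_S_eq_neg_one, mul_neg_one]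

omit [NeZero N] in
/-- `(TS)² = ST⁻¹`. [folklore] -/
theorem TS_mul_TS : T * S * (T * S) = S * T⁻¹ := by
  ext i j
  fin_cases i <;> fin_cases j <;>
    simp [ModularGroup.coe_S, ModularGroup.coe_T, Matrix.mul_apply, Fin.sum_univ_two]

/-- **The three-term relation `μ(g) + σ_U μ(gU) + σ_U² μ(gU²) = 0`** (`U = TS`, even `n`),
evaluated at `f`: its moment polynomial is the period of `f` over the closed triangle
`{g0, g∞} + {g∞, g1} + {g1, g0}`, which vanishes term by term by
`periodFn_mul_of_apply_one_zero` (`gUS = g(-T)`, `gU²S = gU(-T)`, `gU² = gS T⁻¹`). [folklore] -/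
theorem msymbMoment_three_term (hn : Even n) (g : SL(2, ℤ)) (f : CuspForm (Gamma0 N) (n + 2)) :
    (fun j ↦ msymbMoment n g j f) + (twistU n).mulVec (fun j ↦ msymbMoment n (g * (T * S)) j f) +
      (twistU n).mulVec ((twistU n).mulVec
        (fun j ↦ msymbMoment n (g * (T * S) * (T * S)) j f)) = 0 := by
  refine eq_zero_of_momPoly_eq_zero hn fun p ↦ ?_
  set u : (Fin 2 → ℂ) → (Fin 2 → ℂ) := fun p ↦ ![p 1, p 1 - p 0] with hudef
  have hU : ∀ (y : Fin (n + 1) → ℂ) (q : Fin 2 → ℂ),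
      momPoly n ((twistU n).mulVec y) q = momPoly n y (u q) := fun y q ↦ momPoly_twistU_mulVec y q
  rw [map_add, map_add, Pi.add_apply, Pi.add_apply, hU, hU, hU, momPoly_msymbMoment,
    momPoly_msymbMoment, momPoly_msymbMoment]
  have hT10 : (-T : SL(2, ℤ)) 1 0 = 0 := by simp [ModularGroup.coe_T]
  have hTi10 : (T⁻¹ : SL(2, ℤ)) 1 0 = 0 := by
    simp [Matrix.SpecialLinearGroup.coe_inv, ModularGroup.coe_T, Matrix.adjugate_fin_two]
  -- the three cancellations
  have h1 : periodFn n f (g * (T * S) * S) ![(u p) 1, -(u p) 0] = periodFn n f g p := by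
    rw [mul_assoc, TS_mul_S, periodFn_mul_of_apply_one_zero n f g (-T) hT10]
    congr 1
    funext i
    fin_cases i <;>
      simp [hudef, Matrix.mulVec, dotProduct, Fin.sum_univ_two, ModularGroup.coe_T]
  have h2 : periodFn n f (g * (T * S) * (T * S) * S) ![(u (u p)) 1, -(u (u p)) 0] =
      periodFn n f (g * (T * S)) (u p) := by
    rw [mul_assoc (g * (T * S)), TS_mul_S, periodFn_mul_of_apply_one_zero n f _ (-T) hT10]
    congr 1
    funext i
    fin_cases i <;>
      simp [hudef, Matrix.mulVec, dotProduct, Fin.sum_univ_two, ModularGroup.coe_T]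
  have h3 : periodFn n f (g * (T * S) * (T * S)) (u (u p)) = periodFn n f (g * S) ![p 1, -p 0] := by
    rw [mul_assoc g, TS_mul_TS, ← mul_assoc, periodFn_mul_of_apply_one_zero n f _ T⁻¹ hTi10]
    congr 1
    funext i
    fin_cases i <;>
      simp [hudef, Matrix.mulVec, dotProduct, Fin.sum_univ_two, Matrix.SpecialLinearGroup.coe_inv,
        ModularGroup.coe_T, Matrix.adjugate_fin_two]
  rw [h1, h2, h3]
  ring

end Moments

/-! ### §3. The weight-`k` M-symbol space `𝕄 = (SL(2, ℤ)/Γ₀(N)) → ℚⁿ⁺¹`: M-symbol map, relations,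
boundary -/

section MSpace

open Module LinearMap
open scoped Classical

variable {N : ℕ} [NeZero N] (n : ℕ)

/-- A block operator `(π, A)`: `(m ↦ (y ↦ A (m (π y))))` on `X → ℚⁿ⁺¹`. [folklore] -/
def blockOp {X : Type*} (perm : X → X) (A : Matrix (Fin (n + 1)) (Fin (n + 1)) ℚ) :
    (X → Fin (n + 1) → ℚ) →ₗ[ℚ] (X → Fin (n + 1) → ℚ) where
  toFun m y := A.mulVec (m (perm y))
  map_add' m m' := by funext y; simp [Matrix.mulVec_add]
  map_smul' c m := by funext y; simp [Matrix.mulVec_smul]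

omit [NeZero N] in
/-- Unfolding `blockOp`. [folklore] -/
@[simp] theorem blockOp_apply {X : Type*} (perm : X → X) (A : Matrix (Fin (n + 1)) (Fin (n + 1)) ℚ)
    (m : X → Fin (n + 1) → ℚ) (y : X) : blockOp n perm A m y = A.mulVec (m (perm y)) := rfl

omit [NeZero N] in
/-- **The trace of a block operator is `#Fix(perm) · trace A`.** [folklore] -/
theorem trace_blockOp {X : Type*} [Fintype X] (perm : X → X)
    (A : Matrix (Fin (n + 1)) (Fin (n + 1)) ℚ) :
    LinearMap.trace ℚ _ (blockOp n perm A) = (Nat.card {x // perm x = x} : ℚ) * A.trace := by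
  set b := Pi.basis fun _ : X ↦ Pi.basisFun ℚ (Fin (n + 1)) with hb
  rw [LinearMap.trace_eq_matrix_trace ℚ b, Matrix.trace]
  simp only [Matrix.diag, LinearMap.toMatrix_apply, hb, Pi.basis_repr, Pi.basis_apply,
    Pi.basisFun_repr, Pi.basisFun_apply, blockOp_apply]
  rw [Fintype.sum_sigma]
  dsimp only
  rw [Nat.card_eq_fintype_card, Fintype.card_subtype, Finset.card_eq_sum_ones, Nat.cast_sum,
    Finset.sum_mul, Finset.sum_filter]
  refine Finset.sum_congr rfl fun x _ ↦ ?_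
  by_cases hx : perm x = x
  · rw [hx, if_pos rfl, Nat.cast_one, one_mul, Matrix.trace]
    refine Finset.sum_congr rfl fun j _ ↦ ?_
    rw [Pi.single_eq_same]
    simp [Matrix.mulVec, dotProduct, Pi.single_apply, Matrix.diag]
  · rw [if_neg hx]
    simp [Pi.single_eq_of_ne hx]

/-- **The M-symbol data of a coset** `q = hΓ₀(N) ↦ μ(h⁻¹)` (well defined by `μ(γg) = μ(g)`). [folklore] -/
def msymbK : Gamma0Coset N → Fin (n + 1) → Module.Dual ℂ (CuspForm (Gamma0 N) (n + 2)) :=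
  Quotient.lift (fun h : SL(2, ℤ) ↦ fun j ↦ msymbMoment n h⁻¹ j) fun a b hab ↦ by
    replace hab : a⁻¹ * b ∈ Gamma0 N := QuotientGroup.leftRel_apply.mp hab
    funext j
    have : b⁻¹ = (a⁻¹ * b)⁻¹ * a⁻¹ := by group
    show msymbMoment n a⁻¹ j = msymbMoment n b⁻¹ j
    rw [this, msymbMoment_gamma0_mul n (inv_mem hab)]

/-- `msymbK` on a representative. [folklore] -/
@[simp] theorem msymbK_mk (h : SL(2, ℤ)) (j : Fin (n + 1)) :
    msymbK n (h : Gamma0Coset N) j = msymbMoment n h⁻¹ j := rfl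

/-- `msymbK` on a representative, as a vector. [folklore] -/
theorem msymbK_mk_fun (h : SL(2, ℤ)) :
    msymbK n (h : Gamma0Coset N) = fun j ↦ msymbMoment n h⁻¹ j := rfl

/-- The action of a rational matrix on vectors of functionals. [folklore] -/
def matAct (A : Matrix (Fin (n + 1)) (Fin (n + 1)) ℚ)
    (w : Fin (n + 1) → Module.Dual ℂ (CuspForm (Gamma0 N) (n + 2))) :
    Fin (n + 1) → Module.Dual ℂ (CuspForm (Gamma0 N) (n + 2)) := fun j ↦ ∑ i, (A j i) • w i

omit [NeZero N] in
/-- Evaluation: `(A • w)ⱼ(f) = (A_ℂ (w(f)))ⱼ`. [folklore] -/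
theorem matAct_apply (A : Matrix (Fin (n + 1)) (Fin (n + 1)) ℚ)
    (w : Fin (n + 1) → Module.Dual ℂ (CuspForm (Gamma0 N) (n + 2))) (j : Fin (n + 1))
    (f : CuspForm (Gamma0 N) (n + 2)) :
    matAct n A w j f = (A.map (Rat.castHom ℂ)).mulVec (fun i ↦ w i f) j := by
  simp only [matAct, LinearMap.coe_sum, Finset.sum_apply, LinearMap.smul_apply, Matrix.mulVec,
    dotProduct, Matrix.map_apply, Rat.coe_castHom]
  refine Finset.sum_congr rfl fun i _ ↦ ?_
  rw [Rat.smul_def]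

omit [NeZero N] in
/-- **Adjointness**: `∑ⱼ (Aᵀv)ⱼ • wⱼ = ∑ⱼ vⱼ • (A • w)ⱼ`. [folklore] -/
theorem sum_transpose_mulVec_smul (A : Matrix (Fin (n + 1)) (Fin (n + 1)) ℚ) (v : Fin (n + 1) → ℚ)
    (w : Fin (n + 1) → Module.Dual ℂ (CuspForm (Gamma0 N) (n + 2))) :
    ∑ j, (A.transpose.mulVec v j) • w j = ∑ j, (v j) • matAct n A w j := by
  simp only [Matrix.mulVec, dotProduct, Matrix.transpose_apply, matAct, Finset.sum_smul,
    Finset.smul_sum, smul_smul]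
  rw [Finset.sum_comm]
  refine Finset.sum_congr rfl fun i _ ↦ Finset.sum_congr rfl fun j _ ↦ ?_
  rw [mul_comm]

/-- The twists over `ℚ` and over `ℂ` agree: `σ_S`. [folklore] -/
theorem twistS_map : (twistS (K := ℚ) n).map (Rat.castHom ℂ) = twistS (K := ℂ) n := by
  ext j i
  simp only [Matrix.map_apply, twistS, Matrix.of_apply, Rat.coe_castHom]
  split_ifs <;> simp

/-- The twists over `ℚ` and over `ℂ` agree: `σ_T`. [folklore] -/
theorem twistP_map : (twistP (K := ℚ) n).map (Rat.castHom ℂ) = twistP (K := ℂ) n := by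
  ext j i
  simp only [Matrix.map_apply, twistP, Matrix.of_apply, Rat.coe_castHom]
  split_ifs <;> simp

/-- The twists over `ℚ` and over `ℂ` agree: `σ_U`. [folklore] -/
theorem twistU_map : (twistU (K := ℚ) n).map (Rat.castHom ℂ) = twistU (K := ℂ) n := by
  rw [twistU, Matrix.map_mul, twistP_map, twistS_map, twistU]

/-- **The two-term relation for the coset data**: `M(q) + σ_S • M(S⁻¹q) = 0`. [folklore] -/
theorem msymbK_two_term (hn : Even n) (q : Gamma0Coset N) (j : Fin (n + 1)) :
    msymbK n q j + matAct n (twistS n) (msymbK n (S⁻¹ • q)) j = 0 := by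
  induction q using QuotientGroup.induction_on with
  | H h =>
    rw [MulAction.Quotient.smul_mk, smul_eq_mul, msymbK_mk, msymbK_mk_fun, mul_inv_rev, inv_inv]
    ext f
    rw [LinearMap.add_apply, matAct_apply, twistS_map, LinearMap.zero_apply]
    have := congrFun (msymbMoment_two_term n hn h⁻¹ f) j
    simpa using this

/-- **The three-term relation for the coset data**:
`M(q) + σ_U • M((TS)⁻¹q) + σ_U • σ_U • M((TS)⁻²q) = 0`. [folklore] -/
theorem msymbK_three_term (hn : Even n) (q : Gamma0Coset N) (j : Fin (n + 1)) :
    msymbK n q j + matAct n (twistU n) (msymbK n ((T * S)⁻¹ • q)) j +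
      matAct n (twistU n) (matAct n (twistU n) (msymbK n (((T * S)⁻¹) ^ 2 • q))) j = 0 := by
  induction q using QuotientGroup.induction_on with
  | H h =>
    rw [MulAction.Quotient.smul_mk, MulAction.Quotient.smul_mk, smul_eq_mul, smul_eq_mul, msymbK_mk,
      msymbK_mk_fun, msymbK_mk_fun, mul_inv_rev, inv_inv, mul_inv_rev, inv_pow, inv_inv]
    ext f
    rw [LinearMap.add_apply, LinearMap.add_apply, matAct_apply, matAct_apply, twistU_map,
      LinearMap.zero_apply]
    have e : (fun i ↦ matAct n (twistU n) (fun j ↦ msymbMoment n (h⁻¹ * (T * S) ^ 2) j) i f) =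
        (twistU (K := ℂ) n).mulVec fun i ↦ msymbMoment n (h⁻¹ * (T * S) ^ 2) i f := by
      funext i
      rw [matAct_apply, twistU_map]
    rw [e]
    have := congrFun (msymbMoment_three_term n hn h⁻¹ f) j
    simpa [pow_two, mul_assoc] using this

variable (N)

/-- **The weight-`k` M-symbol map** `Ψ : 𝕄 → S_{n+2}(Γ₀(N))^∧`, `m ↦ ∑_q ∑ⱼ m(q)ⱼ M(q)ⱼ`. [folklore] -/
def msymbKMap : (Gamma0Coset N → Fin (n + 1) → ℚ) →ₗ[ℚ] Module.Dual ℂ (CuspForm (Gamma0 N) (n + 2)) where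
  toFun m := ∑ q, ∑ j, (m q j) • msymbK n q j
  map_add' m m' := by
    simp only [Pi.add_apply, add_smul, Finset.sum_add_distrib]
  map_smul' c m := by
    simp only [Pi.smul_apply, smul_eq_mul, RingHom.id_apply, Finset.smul_sum, smul_smul]

/-- The two-term relation operator `(S, σ_Sᵀ)`. [folklore] -/
def opS : (Gamma0Coset N → Fin (n + 1) → ℚ) →ₗ[ℚ] (Gamma0Coset N → Fin (n + 1) → ℚ) :=
  blockOp n (fun y : Gamma0Coset N ↦ S • y) (twistS n).transpose

/-- The three-term relation operator `(TS, σ_Uᵀ)`. [folklore] -/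
def opU : (Gamma0Coset N → Fin (n + 1) → ℚ) →ₗ[ℚ] (Gamma0Coset N → Fin (n + 1) → ℚ) :=
  blockOp n (fun y : Gamma0Coset N ↦ (T * S) • y) (twistU n).transpose

/-- **The boundary map** `δ : 𝕄 → ℚ^{cusps}`, `e_q ⊗ v ↦ vₙ[q⁻¹∞] - v₀[q⁻¹0]`. [folklore] -/
def bdryKMap : (Gamma0Coset N → Fin (n + 1) → ℚ) →ₗ[ℚ]
    (CuspOrbits (Gamma0 N : Subgroup (GL (Fin 2) ℝ)) → ℚ) where
  toFun m := ∑ q, ((m q (Fin.last n)) • Pi.single (cuspInfty N q) (1 : ℚ) -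
    (m q 0) • Pi.single (cuspInfty N (S⁻¹ • q)) (1 : ℚ))
  map_add' m m' := by
    rw [← Finset.sum_add_distrib]
    refine Finset.sum_congr rfl fun q _ ↦ ?_
    simp only [Pi.add_apply, add_smul]
    abel
  map_smul' c m := by
    simp only [Pi.smul_apply, smul_eq_mul, RingHom.id_apply, Finset.smul_sum, smul_sub, smul_smul]

variable {N}

/-- `Ψ(e_q ⊗ v) = ∑ⱼ vⱼ M(q)ⱼ`. [folklore] -/
theorem msymbKMap_single (q : Gamma0Coset N) (v : Fin (n + 1) → ℚ) :
    msymbKMap N n (Pi.single q v) = ∑ j, (v j) • msymbK n q j := by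
  simp only [msymbKMap, LinearMap.coe_mk, AddHom.coe_mk]
  rw [Finset.sum_eq_single q (fun q' _ hq' ↦ by simp [Pi.single_eq_of_ne hq']) (by simp)]
  simp

/-- `δ(e_q ⊗ v) = vₙ[q⁻¹∞] - v₀[q⁻¹0]`. [folklore] -/
theorem bdryKMap_single (q : Gamma0Coset N) (v : Fin (n + 1) → ℚ) :
    bdryKMap N n (Pi.single q v) =
      (v (Fin.last n)) • Pi.single (cuspInfty N q) (1 : ℚ) - (v 0) • Pi.single (cuspInfty N (S⁻¹ • q)) 1 := by
  simp only [bdryKMap, LinearMap.coe_mk, AddHom.coe_mk]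
  rw [Finset.sum_eq_single q (fun q' _ hq' ↦ by simp [Pi.single_eq_of_ne hq']) (by simp)]
  simp

omit [NeZero N] in
/-- `opS (e_q ⊗ v) = e_{S⁻¹q} ⊗ σ_Sᵀ v`. [folklore] -/
theorem opS_single (q : Gamma0Coset N) (v : Fin (n + 1) → ℚ) :
    opS N n (Pi.single q v) = Pi.single (S⁻¹ • q) ((twistS n).transpose.mulVec v) := by
  funext y
  simp only [opS, blockOp_apply]
  by_cases hy : y = S⁻¹ • q
  · subst hy
    rw [smul_inv_smul, Pi.single_eq_same, Pi.single_eq_same]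
  · have : S • y ≠ q := fun h ↦ hy (by rw [← h, inv_smul_smul])
    rw [Pi.single_eq_of_ne hy, Pi.single_eq_of_ne this, Matrix.mulVec_zero]

omit [NeZero N] in
/-- `opU (e_q ⊗ v) = e_{(TS)⁻¹q} ⊗ σ_Uᵀ v`. [folklore] -/
theorem opU_single (q : Gamma0Coset N) (v : Fin (n + 1) → ℚ) :
    opU N n (Pi.single q v) = Pi.single ((T * S)⁻¹ • q) ((twistU n).transpose.mulVec v) := by
  funext y
  simp only [opU, blockOp_apply]
  by_cases hy : y = (T * S)⁻¹ • q
  · subst hy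
    rw [smul_inv_smul, Pi.single_eq_same, Pi.single_eq_same]
  · have : (T * S) • y ≠ q := fun h ↦ hy (by rw [← h, inv_smul_smul])
    rw [Pi.single_eq_of_ne hy, Pi.single_eq_of_ne this, Matrix.mulVec_zero]

/-- Linear maps on `𝕄` agreeing on elementary symbols `e_q ⊗ v` are equal. [folklore] -/
theorem linearMap_ext_single {W : Type*} [AddCommGroup W] [Module ℚ W]
    {F G : (Gamma0Coset N → Fin (n + 1) → ℚ) →ₗ[ℚ] W}
    (h : ∀ q v, F (Pi.single q v) = G (Pi.single q v)) : F = G := by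
  apply LinearMap.ext
  intro m
  rw [← Finset.univ_sum_single m, map_sum, map_sum]
  exact Finset.sum_congr rfl fun q _ ↦ h q (m q)

/-- **The two-term relations are relations**: `Ψ ∘ (1 + opS) = 0` (even `n`). [folklore] -/
theorem msymbKMap_comp_relTwo (hn : Even n) :
    msymbKMap N n ∘ₗ (LinearMap.id + opS N n) = 0 := by
  refine linearMap_ext_single n fun q v ↦ ?_
  rw [LinearMap.comp_apply, LinearMap.add_apply, LinearMap.id_apply, map_add, opS_single,
    msymbKMap_single, msymbKMap_single, sum_transpose_mulVec_smul, LinearMap.zero_apply,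
    ← Finset.sum_add_distrib]
  refine Finset.sum_eq_zero fun j _ ↦ ?_
  rw [← smul_add, msymbK_two_term n hn, smul_zero]

/-- **The three-term relations are relations**: `Ψ ∘ (1 + opU + opU²) = 0` (even `n`). [folklore] -/
theorem msymbKMap_comp_relThree (hn : Even n) :
    msymbKMap N n ∘ₗ (LinearMap.id + opU N n + opU N n ∘ₗ opU N n) = 0 := by
  refine linearMap_ext_single n fun q v ↦ ?_
  rw [LinearMap.comp_apply, LinearMap.add_apply, LinearMap.add_apply, LinearMap.id_apply,
    LinearMap.comp_apply, map_add, map_add, opU_single, opU_single, ← mul_smul, ← pow_two,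
    msymbKMap_single, msymbKMap_single, msymbKMap_single, sum_transpose_mulVec_smul,
    sum_transpose_mulVec_smul, sum_transpose_mulVec_smul, LinearMap.zero_apply,
    ← Finset.sum_add_distrib, ← Finset.sum_add_distrib]
  refine Finset.sum_eq_zero fun j _ ↦ ?_
  rw [← smul_add, ← smul_add, msymbK_three_term n hn, smul_zero]

/-- `σ_S` is symmetric (even `n`). [folklore] -/
theorem twistS_transpose (hn : Even n) : (twistS (K := ℚ) n).transpose = twistS n := by
  ext j i
  simp only [Matrix.transpose_apply, twistS, Matrix.of_apply]
  by_cases h : j = Fin.rev i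
  · have h' : i = Fin.rev j := by rw [h, Fin.rev_rev]
    rw [if_pos h, if_pos h', h', val_rev_eq, neg_one_pow_sub_of_even hn (fin_le j)]
  · have h' : ¬ i = Fin.rev j := fun h' ↦ h (by rw [h', Fin.rev_rev])
    rw [if_neg h, if_neg h']

/-- `(Aᵀ v)ⱼ = ⟨A δⱼ, v⟩`. [folklore] -/
theorem transpose_mulVec_eq_dotProduct (A : Matrix (Fin (n + 1)) (Fin (n + 1)) ℚ)
    (v : Fin (n + 1) → ℚ) (j : Fin (n + 1)) :
    A.transpose.mulVec v j = dotProduct (A.mulVec (Pi.single j 1)) v := by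
  simp [Matrix.mulVec, dotProduct, Matrix.transpose_apply, Pi.single_apply]

/-- **The two-term relations have zero boundary** (even `n`). [folklore] -/
theorem bdryKMap_comp_relTwo (hn : Even n) :
    bdryKMap N n ∘ₗ (LinearMap.id + opS N n) = 0 := by
  refine linearMap_ext_single n fun q v ↦ ?_
  rw [LinearMap.comp_apply, LinearMap.add_apply, LinearMap.id_apply, map_add, opS_single,
    bdryKMap_single, bdryKMap_single, twistS_transpose n hn, twistS_mulVec, twistS_mulVec,
    S_inv_smul_S_inv_smul, LinearMap.zero_apply]
  have h1 : Fin.rev (Fin.last n) = 0 := by apply Fin.ext; rw [val_rev_eq]; simp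
  have h2 : Fin.rev (0 : Fin (n + 1)) = Fin.last n := by apply Fin.ext; rw [val_rev_eq]; simp
  rw [h1, h2, Fin.val_last, hn.neg_one_pow, Fin.val_zero, pow_zero, one_mul, one_mul]
  abel

/-- **The three-term relations have zero boundary** (even `n`): the columns `σ_U δ₀ = δₙ`,
`σ_U δₙ = 𝟙`, `σ_U 𝟙 = δ₀` and the cusps of the triangle (`cuspInfty_three_term`). [folklore] -/
theorem bdryKMap_comp_relThree (hn : Even n) :
    bdryKMap N n ∘ₗ (LinearMap.id + opU N n + opU N n ∘ₗ opU N n) = 0 := by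
  refine linearMap_ext_single n fun q v ↦ ?_
  obtain ⟨c1, c2, c3⟩ := cuspInfty_three_term q
  rw [LinearMap.comp_apply, LinearMap.add_apply, LinearMap.add_apply, LinearMap.id_apply,
    LinearMap.comp_apply, map_add, map_add, opU_single, opU_single, ← mul_smul, ← pow_two,
    Matrix.mulVec_mulVec, ← Matrix.transpose_mul, bdryKMap_single, bdryKMap_single,
    bdryKMap_single, transpose_mulVec_eq_dotProduct, transpose_mulVec_eq_dotProduct,
    transpose_mulVec_eq_dotProduct, transpose_mulVec_eq_dotProduct, ← Matrix.mulVec_mulVec,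
    ← Matrix.mulVec_mulVec, twistU_mulVec_single_last hn, twistU_mulVec_single_zero hn,
    twistU_mulVec_single_last hn, twistU_mulVec_one hn, c1, c2, c3, LinearMap.zero_apply]
  simp only [dotProduct, Pi.single_apply, one_mul, ite_mul, zero_mul, Finset.sum_ite_eq',
    Finset.mem_univ, if_true]
  abel

end MSpace

/-! ### §4. `σ_T⁻¹`, the trace of `σ_U²`, and the relation operators `1 + opS`, `1 + opU + opU²` -/

section TwistsInv

variable {K : Type*} [Field K] [CharZero K] (n : ℕ)

/-- The twist by `T⁻¹`: the signed Pascal matrix `(σ_T' y)ⱼ = ∑_{i ≤ j} (-1)^{j-i} C(j,i) yᵢ`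
(`σ_T' e(z) = e(z - 1)`). [folklore] -/
def twistPinv : Matrix (Fin (n + 1)) (Fin (n + 1)) K :=
  Matrix.of fun j i ↦ if (i : ℕ) ≤ j then (-1) ^ ((j : ℕ) - i) * (((j : ℕ).choose i : ℕ) : K) else 0

variable {n}

omit [CharZero K] in
/-- `(σ_T' y)ⱼ = ∑ᵢ [i ≤ j] (-1)^{j-i} C(j,i) yᵢ`. [folklore] -/
theorem twistPinv_mulVec (y : Fin (n + 1) → K) (j : Fin (n + 1)) :
    (twistPinv n).mulVec y j =
      ∑ i : Fin (n + 1), (if (i : ℕ) ≤ j then (-1) ^ ((j : ℕ) - i) * (((j : ℕ).choose i : ℕ) : K)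
        else 0) * y i := by
  simp [twistPinv, Matrix.mulVec, dotProduct, Matrix.of_apply]

omit [CharZero K] in
/-- `σ_T' e(z) = e(z - 1)` (binomial theorem). [folklore] -/
theorem twistPinv_mulVec_powVec (z : K) : (twistPinv n).mulVec (powVec n z) = powVec n (z - 1) := by
  funext j
  rw [twistPinv_mulVec, powVec_apply, sub_eq_add_neg, add_pow]
  simp only [powVec_apply]
  rw [Finset.sum_range, Fin.sum_univ_eq_sum_range (fun i ↦
    (if i ≤ (j : ℕ) then (-1) ^ ((j : ℕ) - i) * (((j : ℕ).choose i : ℕ) : K) else 0) * z ^ i) (n + 1)]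
  have hj := fin_le j
  rw [← Finset.sum_range_add_sum_Ico _ (Nat.succ_le_succ hj)]
  rw [Finset.sum_eq_zero (s := Finset.Ico (j + 1 : ℕ) (n + 1)) (fun i hi ↦ by
    rw [Finset.mem_Ico] at hi
    rw [if_neg (by omega), zero_mul]), add_zero,
    ← Fin.sum_univ_eq_sum_range (fun i ↦
      (if i ≤ (j : ℕ) then (-1) ^ ((j : ℕ) - i) * (((j : ℕ).choose i : ℕ) : K) else 0) * z ^ i)]
  refine Finset.sum_congr rfl fun i _ ↦ ?_
  rw [if_pos (Nat.lt_succ_iff.mp i.isLt)]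
  ring

/-- **`momPoly (σ_T' y) (u, v) = momPoly y (u + v, v)`** (`= momPoly y ∘ T`). [folklore] -/
theorem momPoly_twistPinv_mulVec (y : Fin (n + 1) → K) (p : Fin 2 → K) :
    momPoly n ((twistPinv n).mulVec y) p = momPoly n y ![p 0 + p 1, p 1] := by
  obtain ⟨c, rfl⟩ := exists_eq_sum_smul_powVec (K := K) (n := n) (w := fun l : Fin (n + 1) ↦ (l : K))
    (fun a b hab ↦ by
      have h' : ((a : ℕ) : K) = (b : ℕ) := hab
      exact Fin.ext (by exact_mod_cast h')) y
  rw [Matrix.mulVec_sum, map_sum, map_sum]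
  simp only [Finset.sum_apply]
  refine Finset.sum_congr rfl fun l _ ↦ ?_
  rw [Matrix.mulVec_smul, map_smul, map_smul, Pi.smul_apply, Pi.smul_apply, twistPinv_mulVec_powVec]
  congr 1
  set M : Matrix (Fin 2) (Fin 2) K := !![1, 1; 0, 1] with hM
  have hp : (![p 0 + p 1, p 1] : Fin 2 → K) = M.mulVec p := by
    funext i
    fin_cases i <;> simp [hM, Matrix.mulVec, dotProduct, Fin.sum_univ_two]
  rw [hp, momPoly_powVec_mulVec M (z := (l : K)) (z' := (l : K) - 1) (by simp [hM]) p]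
  simp [hM]

/-- `σ_T σ_T' = 1`. [folklore] -/
theorem twistP_mul_twistPinv (hn : Even n) : twistP n * twistPinv n = (1 : Matrix _ _ K) := by
  refine Matrix.ext_iff_mulVec.mpr fun y ↦ ?_
  rw [← Matrix.mulVec_mulVec, Matrix.one_mulVec]
  refine eq_of_momPoly_eq hn fun p ↦ ?_
  rw [momPoly_twistP_mulVec, momPoly_twistPinv_mulVec]
  have hv : (![(![p 0 - p 1, p 1] : Fin 2 → K) 0 + (![p 0 - p 1, p 1] : Fin 2 → K) 1,
      (![p 0 - p 1, p 1] : Fin 2 → K) 1] : Fin 2 → K) = p := by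
    funext i
    fin_cases i <;> simp
  rw [hv]

/-- `σ_U (σ_S σ_T') = 1`. [folklore] -/
theorem twistU_mul_twistS_mul_twistPinv (hn : Even n) :
    twistU n * (twistS n * twistPinv n) = (1 : Matrix _ _ K) := by
  rw [twistU, mul_assoc, ← mul_assoc (twistS n), twistS_mul_twistS hn, one_mul,
    twistP_mul_twistPinv hn]

/-- `σ_U² = σ_S σ_T'` (both are `σ_U⁻¹`). [folklore] -/
theorem twistU_mul_twistU (hn : Even n) : twistU n * twistU n = (twistS n * twistPinv n : Matrix _ _ K) := by
  have h3 : twistU n * (twistU n * twistU n) = (1 : Matrix _ _ K) := by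
    rw [← mul_assoc, ← pow_three', twistU_pow_three hn]
  have h3' := twistU_mul_twistS_mul_twistPinv (K := K) hn
  have hl : twistS n * twistPinv n * twistU n = (1 : Matrix _ _ K) := mul_eq_one_comm.mp h3'
  calc twistU n * twistU n = (twistS n * twistPinv n * twistU n) * (twistU n * twistU n) := by
        rw [hl, one_mul]
    _ = twistS n * twistPinv n * (twistU n * (twistU n * twistU n)) := by
        simp only [mul_assoc]
    _ = twistS n * twistPinv n := by rw [h3, mul_one]

/-- **`trace σ_U² = A(n)`** (even `n`): the diagonal of `σ_T' σ_S` is again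
`(-1)ʲ C(j, n-j)`. [folklore] -/
theorem trace_twistU_mul_twistU (hn : Even n) :
    Matrix.trace (twistU n * twistU n : Matrix _ _ K) = (altFib n : K) := by
  rw [twistU_mul_twistU hn, Matrix.trace_mul_comm, Matrix.trace, altFib]
  push_cast
  rw [Finset.sum_range]
  refine Fintype.sum_equiv Fin.revPerm _ _ fun j ↦ ?_
  have hj := fin_le j
  simp only [Matrix.diag, Matrix.mul_apply, twistPinv, twistS, Matrix.of_apply,
    Fin.revPerm_apply, val_rev_eq]
  rw [Finset.sum_eq_single (Fin.rev j) (fun x _ hx ↦ ?_) (by simp)]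
  · simp only [Fin.rev_rev, if_true, val_rev_eq]
    rw [Nat.sub_sub_self hj]
    by_cases h : n - (j : ℕ) ≤ j
    · rw [if_pos h]
      obtain ⟨m, hm⟩ := hn
      have e2 : (-1 : K) ^ ((j : ℕ) - (n - j)) = 1 := by
        rw [show (j : ℕ) - (n - j) = 2 * ((j : ℕ) - m) by omega, pow_mul]
        simp
      rw [e2, one_mul, mul_comm]
    · rw [if_neg h, Nat.choose_eq_zero_of_lt (by omega)]
      simp
  · rw [if_neg (show ¬ (j = Fin.rev x) from fun h ↦ hx (by rw [h, Fin.rev_rev])), mul_zero]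

end TwistsInv

section RelOps

open Module LinearMap
open scoped Classical

variable {N : ℕ} [NeZero N] (n : ℕ)

variable (N)

/-- The two-term relation operator `1 + opS`. [folklore] -/
def relTwoK : (Gamma0Coset N → Fin (n + 1) → ℚ) →ₗ[ℚ] (Gamma0Coset N → Fin (n + 1) → ℚ) :=
  LinearMap.id + opS N n

/-- The three-term relation operator `1 + opU + opU²`. [folklore] -/
def relThreeK : (Gamma0Coset N → Fin (n + 1) → ℚ) →ₗ[ℚ] (Gamma0Coset N → Fin (n + 1) → ℚ) :=
  LinearMap.id + opU N n + opU N n ∘ₗ opU N n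

/-- The weight-`k` relation module `Rel = range(1 + opS) + range(1 + opU + opU²)`. [folklore] -/
def relModuleK : Submodule ℚ (Gamma0Coset N → Fin (n + 1) → ℚ) :=
  LinearMap.range (relTwoK N n) ⊔ LinearMap.range (relThreeK N n)

/-- `opS`-invariant symbols. [folklore] -/
def fixedOpS : Submodule ℚ (Gamma0Coset N → Fin (n + 1) → ℚ) := LinearMap.ker (opS N n - LinearMap.id)

/-- `opU`-invariant symbols. [folklore] -/
def fixedOpU : Submodule ℚ (Gamma0Coset N → Fin (n + 1) → ℚ) := LinearMap.ker (opU N n - LinearMap.id)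

variable {N}

omit [NeZero N] in
/-- `(TS)⁻³` acts trivially on the cosets. [folklore] -/
theorem TS_inv_smul_three (q : Gamma0Coset N) : (T * S)⁻¹ • (T * S)⁻¹ • (T * S)⁻¹ • q = q := by
  rw [← mul_smul, ← mul_smul,
    show (T * S)⁻¹ * (T * S)⁻¹ * (T * S)⁻¹ = (T * S * (T * S) * (T * S))⁻¹ by group,
    TS_pow_three_eq, inv_neg, inv_one, neg_one_smul_coset]

/-- `opS² = 1` (even `n`). [folklore] -/
theorem opS_comp_opS (hn : Even n) : opS N n ∘ₗ opS N n = LinearMap.id := by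
  refine linearMap_ext_single n fun q v ↦ ?_
  rw [LinearMap.comp_apply, opS_single, opS_single, S_inv_smul_S_inv_smul, twistS_transpose n hn,
    twistS_mulVec_twistS_mulVec hn, LinearMap.id_apply]

/-- `opU³ = 1` (even `n`). [folklore] -/
theorem opU_comp_opU_comp_opU (hn : Even n) :
    opU N n ∘ₗ (opU N n ∘ₗ opU N n) = LinearMap.id := by
  refine linearMap_ext_single n fun q v ↦ ?_
  rw [LinearMap.comp_apply, LinearMap.comp_apply, opU_single, opU_single, opU_single,
    TS_inv_smul_three, Matrix.mulVec_mulVec, Matrix.mulVec_mulVec, ← Matrix.transpose_mul,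
    ← Matrix.transpose_mul, ← mul_assoc, ← pow_three', twistU_pow_three hn, Matrix.transpose_one,
    Matrix.one_mulVec, LinearMap.id_apply]

/-- `(1 + opS)² = 2(1 + opS)`. [folklore] -/
theorem relTwoK_comp_relTwoK (hn : Even n) :
    relTwoK N n ∘ₗ relTwoK N n = (2 : ℚ) • relTwoK N n := by
  rw [show (2 : ℚ) = ((2 : ℕ) : ℚ) by norm_num, Nat.cast_smul_eq_nsmul]
  simp only [relTwoK, LinearMap.add_comp, LinearMap.comp_add, LinearMap.id_comp, LinearMap.comp_id,
    opS_comp_opS n hn]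
  abel

/-- `(1 + opU + opU²)² = 3(1 + opU + opU²)`. [folklore] -/
theorem relThreeK_comp_relThreeK (hn : Even n) :
    relThreeK N n ∘ₗ relThreeK N n = (3 : ℚ) • relThreeK N n := by
  rw [show (3 : ℚ) = ((3 : ℕ) : ℚ) by norm_num, Nat.cast_smul_eq_nsmul]
  have h3 := opU_comp_opU_comp_opU (N := N) n hn
  simp only [relThreeK, LinearMap.add_comp, LinearMap.comp_add, LinearMap.id_comp, LinearMap.comp_id,
    LinearMap.comp_assoc, h3]
  abel

/-- `range(1 + opS) ⊆ Fix(opS)`. [folklore] -/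
theorem range_relTwoK_le (hn : Even n) : LinearMap.range (relTwoK N n) ≤ fixedOpS N n := by
  rintro _ ⟨c, rfl⟩
  rw [fixedOpS, LinearMap.mem_ker, LinearMap.sub_apply, sub_eq_zero, LinearMap.id_apply]
  have h := congrArg (fun f ↦ f c) (opS_comp_opS (N := N) n hn)
  simp only [LinearMap.comp_apply, LinearMap.id_apply] at h
  simp only [relTwoK, LinearMap.add_apply, LinearMap.id_apply, map_add, h]
  abel

/-- `range(1 + opU + opU²) ⊆ Fix(opU)`. [folklore] -/
theorem range_relThreeK_le (hn : Even n) : LinearMap.range (relThreeK N n) ≤ fixedOpU N n := by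
  rintro _ ⟨c, rfl⟩
  rw [fixedOpU, LinearMap.mem_ker, LinearMap.sub_apply, sub_eq_zero, LinearMap.id_apply]
  have h := congrArg (fun f ↦ f c) (opU_comp_opU_comp_opU (N := N) n hn)
  simp only [LinearMap.comp_apply, LinearMap.id_apply] at h
  simp only [relThreeK, LinearMap.add_apply, LinearMap.id_apply, LinearMap.comp_apply, map_add, h]
  abel

/-- `Rel ⊆ ker Ψ`. [folklore] -/
theorem relModuleK_le_ker_msymbKMap (hn : Even n) :
    relModuleK N n ≤ LinearMap.ker (msymbKMap N n) := by
  refine sup_le ?_ ?_ <;> rw [LinearMap.range_le_ker_iff]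
  · exact msymbKMap_comp_relTwo n hn
  · exact msymbKMap_comp_relThree n hn

/-- `Rel ⊆ ker δ`. [folklore] -/
theorem relModuleK_le_ker_bdryKMap (hn : Even n) :
    relModuleK N n ≤ LinearMap.ker (bdryKMap N n) := by
  refine sup_le ?_ ?_ <;> rw [LinearMap.range_le_ker_iff]
  · exact bdryKMap_comp_relTwo n hn
  · exact bdryKMap_comp_relThree n hn

/-- `dim 𝕄 = μ(n + 1)`. [folklore] -/
theorem finrank_mspace :
    Module.finrank ℚ (Gamma0Coset N → Fin (n + 1) → ℚ) = Fintype.card (Gamma0Coset N) * (n + 1) := by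
  rw [Module.finrank_pi_fintype]
  simp

omit [NeZero N] in
/-- `opU² = ((TS)², (σ_U²)ᵀ)`. [folklore] -/
theorem opU_comp_opU_eq :
    opU N n ∘ₗ opU N n = blockOp n (fun y : Gamma0Coset N ↦ (T * S) • (T * S) • y)
      (Matrix.transpose (twistU (K := ℚ) n * twistU n)) := by
  apply LinearMap.ext
  intro m
  funext y
  simp only [LinearMap.comp_apply, opU, blockOp_apply, Matrix.mulVec_mulVec, Matrix.transpose_mul]

/-- **`2 dim range(1 + opS) = μ(n+1) + ε₂'·(-1)^{n/2}`** (`trace opS = ε₂' trace σ_S`). [folklore] -/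
theorem two_mul_finrank_range_relTwoK (hn : Even n) :
    2 * (Module.finrank ℚ (LinearMap.range (relTwoK N n)) : ℚ) =
      Fintype.card (Gamma0Coset N) * (n + 1) +
        Nat.card {q : Gamma0Coset N // S • q = q} * (-1) ^ (n / 2) := by
  have h := ManinCount.trace_eq_mul_finrank_range (relTwoK N n) two_ne_zero (relTwoK_comp_relTwoK n hn)
  have htr : LinearMap.trace ℚ _ (relTwoK N n) = Fintype.card (Gamma0Coset N) * (n + 1) +
      Nat.card {q : Gamma0Coset N // S • q = q} * (-1) ^ (n / 2) := by
    rw [relTwoK, map_add, LinearMap.trace_id, finrank_mspace, opS, trace_blockOp, Matrix.trace_transpose,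
      trace_twistS hn]
    push_cast
    rfl
  rw [htr] at h
  linear_combination -h

omit [NeZero N] in
/-- The cosets fixed by `(TS)²` are those fixed by `TS`. [folklore] -/
theorem nat_card_fixed_TS_TS :
    Nat.card {q : Gamma0Coset N // (T * S) • (T * S) • q = q} =
      Nat.card {q : Gamma0Coset N // (T * S) • q = q} :=
  Nat.card_congr (Equiv.subtypeEquivRight fun q ↦ TS_smul_iff q)

/-- **`3 dim range(1 + opU + opU²) = μ(n+1) + 2ε₃'·A(n)`** (`trace opU = trace opU² = ε₃' A(n)`). [folklore] -/
theorem three_mul_finrank_range_relThreeK (hn : Even n) :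
    3 * (Module.finrank ℚ (LinearMap.range (relThreeK N n)) : ℚ) =
      Fintype.card (Gamma0Coset N) * (n + 1) +
        2 * Nat.card {q : Gamma0Coset N // (T * S) • q = q} * (altFib n : ℚ) := by
  have h := ManinCount.trace_eq_mul_finrank_range (relThreeK N n) three_ne_zero
    (relThreeK_comp_relThreeK n hn)
  have htr : LinearMap.trace ℚ _ (relThreeK N n) = Fintype.card (Gamma0Coset N) * (n + 1) +
      2 * Nat.card {q : Gamma0Coset N // (T * S) • q = q} * (altFib n : ℚ) := by
    rw [relThreeK, map_add, map_add, LinearMap.trace_id, finrank_mspace, opU_comp_opU_eq, opU,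
      trace_blockOp, trace_blockOp, Matrix.trace_transpose, Matrix.trace_transpose, trace_twistU,
      trace_twistU_mul_twistU hn]
    have e := nat_card_fixed_TS_TS (N := N)
    rw [e]
    push_cast
    ring
  rw [htr] at h
  linear_combination -h

end RelOps

/-! ### §5. `Fix(opS) ∩ Fix(opU) = 0`, surjectivity of `δ`, and the rank bound `dim Ψ(ker δ) ≤ 2 dim S_k` -/

section Count

open Module LinearMap
open scoped Classical

variable {N : ℕ} [NeZero N] (n : ℕ)

/-- `det σ_T = 1` (lower triangular with unit diagonal). [folklore] -/
theorem det_twistP : (twistP (K := ℚ) n).det = 1 := by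
  rw [Matrix.det_of_lowerTriangular (twistP n) ?_]
  · simp [twistP]
  · intro i j hij
    have hij' : (i : ℕ) < j := by simpa using hij
    simp only [twistP, Matrix.of_apply]
    rw [if_neg (by omega)]

/-- `σ_Tᵀ v = 0 ⇒ v = 0`. [folklore] -/
theorem eq_zero_of_twistP_transpose_mulVec_eq_zero {v : Fin (n + 1) → ℚ}
    (h : (twistP n).transpose.mulVec v = 0) : v = 0 :=
  Matrix.eq_zero_of_mulVec_eq_zero (by rw [Matrix.det_transpose, det_twistP]; exact one_ne_zero) h

/-- `σ_Sᵀ σ_Uᵀ = σ_Tᵀ` (even `n`). [folklore] -/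
theorem twistS_transpose_mul_twistU_transpose (hn : Even n) :
    (twistS (K := ℚ) n).transpose * (twistU n).transpose = (twistP n).transpose := by
  rw [← Matrix.transpose_mul, twistU, mul_assoc, twistS_mul_twistS hn, mul_one]

omit [NeZero N] in
/-- An element of `Γ₀(N)` fixes the identity coset. [folklore] -/
theorem smul_mk_one_of_mem {g : SL(2, ℤ)} (hg : g ∈ Gamma0 N) :
    g • ((1 : SL(2, ℤ)) : Gamma0Coset N) = ((1 : SL(2, ℤ)) : Gamma0Coset N) := by
  rw [MulAction.Quotient.smul_mk, smul_eq_mul, mul_one, QuotientGroup.eq, mul_one, inv_mem_iff]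
  exact hg

/-- `σ_S δ₀ = δₙ` (even `n`). [folklore] -/
theorem twistS_mulVec_single_zero (hn : Even n) :
    (twistS (K := ℚ) n).mulVec (Pi.single 0 1) = Pi.single (Fin.last n) 1 := by
  funext j
  rw [twistS_mulVec]
  by_cases hj : j = Fin.last n
  · subst hj
    have : Fin.rev (Fin.last n) = 0 := by apply Fin.ext; rw [val_rev_eq]; simp
    rw [this, Pi.single_eq_same, Pi.single_eq_same, Fin.val_last, hn.neg_one_pow, mul_one]
  · have : Fin.rev j ≠ 0 := by
      intro h
      apply hj
      apply Fin.ext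
      have := congrArg Fin.val h
      rw [val_rev_eq] at this
      simp only [Fin.val_zero] at this
      rw [Fin.val_last]
      omega
    rw [Pi.single_eq_of_ne this, Pi.single_eq_of_ne hj, mul_zero]

/-- **`Fix(opS) ∩ Fix(opU) = 0`** (even `n ≠ 0`): an `opS`- and `opU`-invariant symbol `m`
satisfies `σ_Tᵀ m(Ty) = m(y)`; at the identity coset `y₀` (`Ty₀ = y₀`) this forces
`m(y₀) = c δ₀` (`eq_smul_single_of_twistP_transpose_mulVec`), and the relation for
`S Tᴺ S ∈ Γ₀(N)` makes `c δₙ` a fixed vector of `(σ_Tᴺ)ᵀ`, whose pairing with `δ₀` is `c Nⁿ` versus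
`0`; so `m(y₀) = 0`, and then `m = 0` since `S, T` generate `SL(2, ℤ)` acting transitively on the
cosets. (The weight-`k` replacement of "invariant chains are constant": `Symⁿ` has no
`Γ₀(N)`-invariants for `n ≥ 1`.) [folklore] -/
theorem fixedOpS_inf_fixedOpU_eq_bot (hn : Even n) (hn0 : n ≠ 0) :
    fixedOpS N n ⊓ fixedOpU N n = ⊥ := by
  rw [eq_bot_iff]
  rintro m ⟨hS, hU⟩
  simp only [fixedOpS, fixedOpU, SetLike.mem_coe, LinearMap.mem_ker, LinearMap.sub_apply, sub_eq_zero,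
    LinearMap.id_apply] at hS hU
  rw [Submodule.mem_bot]
  set A : Matrix (Fin (n + 1)) (Fin (n + 1)) ℚ := (twistS n).transpose with hA
  set B : Matrix (Fin (n + 1)) (Fin (n + 1)) ℚ := (twistP n).transpose with hB
  have hAA : ∀ v : Fin (n + 1) → ℚ, A.mulVec (A.mulVec v) = v := fun v ↦ by
    rw [hA, twistS_transpose n hn, twistS_mulVec_twistS_mulVec hn]
  have hS' : ∀ y, A.mulVec (m (S • y)) = m y := fun y ↦ congrFun hS y
  have hU' : ∀ y, (twistU n).transpose.mulVec (m ((T * S) • y)) = m y := fun y ↦ congrFun hU y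
  -- `m(Sy) = A m(y)` and `m(S⁻¹y) = A m(y)`
  have hS1 : ∀ y, m (S • y) = A.mulVec (m y) := fun y ↦ by
    have := hS' (S • y)
    rw [smul_smul, S_mul_S_eq_neg_one, neg_one_smul_coset] at this
    exact this.symm
  have hS2 : ∀ y, m (S⁻¹ • y) = A.mulVec (m y) := fun y ↦ by
    have := hS1 (S⁻¹ • y)
    rw [smul_inv_smul] at this
    rw [this, hAA]
  -- `B m(Ty) = m(y)`
  have hT : ∀ y, B.mulVec (m (T • y)) = m y := fun y ↦ by
    have h1 := hU' (S⁻¹ • y)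
    rw [smul_smul, mul_assoc, mul_inv_cancel, mul_one, hS2] at h1
    have h2 := congrArg A.mulVec h1
    rw [hAA, Matrix.mulVec_mulVec, hA, twistS_transpose_mul_twistU_transpose n hn] at h2
    exact h2
  have hTk : ∀ (k : ℕ) (y : Gamma0Coset N), (B ^ k).mulVec (m (T ^ k • y)) = m y := by
    intro k
    induction k with
    | zero => intro y; simp
    | succ k ih =>
      intro y
      rw [pow_succ, pow_succ', mul_smul, ← Matrix.mulVec_mulVec, hT, ih]
  -- at the identity coset
  set y₀ : Gamma0Coset N := ((1 : SL(2, ℤ)) : Gamma0Coset N) with hy₀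
  set v₀ := m y₀ with hv₀def
  have hv0T : B.mulVec v₀ = v₀ := by
    have := hT y₀
    rwa [hy₀, smul_mk_one_of_mem (T_mem_Gamma0 N)] at this
  have hv0 : v₀ = v₀ 0 • Pi.single 0 1 := eq_smul_single_of_twistP_transpose_mulVec hv0T
  -- the relation for `S T^N S`
  have hfix : (B ^ N).mulVec (A.mulVec v₀) = A.mulVec v₀ := by
    have e1 : v₀ = m ((S * T ^ (N : ℤ) * S⁻¹) • y₀) := by
      rw [hy₀, smul_mk_one_of_mem (conj_T_zpow_mem_Gamma0 S)]
    rw [mul_smul, mul_smul, zpow_natCast, hS1] at e1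
    have e2 := hTk N (S⁻¹ • y₀)
    rw [hS2] at e2
    have e3 : m (T ^ N • S⁻¹ • y₀) = A.mulVec v₀ := by
      have := congrArg A.mulVec e1
      rw [hAA] at this
      exact this.symm
    rw [e3] at e2
    exact e2
  have hc : v₀ 0 = 0 := by
    set c := v₀ 0 with hc
    have hu : A.mulVec v₀ = c • Pi.single (Fin.last n) 1 := by
      conv_lhs => rw [hv0]
      rw [Matrix.mulVec_smul, hA, twistS_transpose n hn, twistS_mulVec_single_zero n hn]
    rw [hu, Matrix.mulVec_smul] at hfix
    have h0l : (0 : Fin (n + 1)) ≠ Fin.last n := by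
      intro h
      have := congrArg Fin.val h
      rw [Fin.val_zero, Fin.val_last] at this
      exact hn0 this.symm
    have h0 := congrFun hfix 0
    simp only [Pi.smul_apply, smul_eq_mul] at h0
    rw [hB, ← Matrix.transpose_pow, transpose_mulVec_eq_dotProduct, twistP_pow_mulVec_single_zero,
      dotProduct, Finset.sum_eq_single (Fin.last n) (fun j _ hj ↦ by simp [hj]) (by simp),
      powVec_apply, Pi.single_eq_same, Pi.single_eq_of_ne h0l, mul_zero,
      mul_one, Fin.val_last] at h0
    have hN : ((N : ℚ)) ^ n ≠ 0 := pow_ne_zero _ (by exact_mod_cast NeZero.ne N)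
    exact (mul_eq_zero.mp h0).resolve_right hN
  have hv00 : v₀ = 0 := by rw [hv0, hc, zero_smul]
  -- propagate along `SL(2, ℤ) = ⟨S, T⟩`
  let K : Subgroup SL(2, ℤ) :=
    { carrier := {g | ∀ y, m (g • y) = 0 ↔ m y = 0}
      mul_mem' := fun {a b} ha hb y ↦ by rw [mul_smul, ha, hb]
      one_mem' := fun y ↦ by rw [one_smul]
      inv_mem' := fun {a} ha y ↦ by rw [← ha (a⁻¹ • y), smul_inv_smul] }
  have hSK : S ∈ K := fun y ↦ by
    rw [hS1]
    constructor
    · intro h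
      have := congrArg A.mulVec h
      rwa [hAA, Matrix.mulVec_zero] at this
    · intro h
      rw [h, Matrix.mulVec_zero]
  have hTK : T ∈ K := fun y ↦ by
    constructor
    · intro h
      rw [← hT y, h, Matrix.mulVec_zero]
    · intro h
      have h1 := hT y
      rw [h] at h1
      exact eq_zero_of_twistP_transpose_mulVec_eq_zero n h1
  have hK : K = ⊤ := by
    rw [eq_top_iff, ← SpecialLinearGroup.SL2Z_generators, Subgroup.closure_le]
    intro g hg
    rcases hg with rfl | rfl
    · exact hSK
    · exact hTK
  have hall : ∀ g : SL(2, ℤ), ∀ y, m (g • y) = 0 ↔ m y = 0 := fun g ↦ (hK ▸ Subgroup.mem_top g : g ∈ K)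
  funext y
  induction y using QuotientGroup.induction_on with
  | H g =>
    have : ((g : SL(2, ℤ)) : Gamma0Coset N) = g • y₀ := by
      rw [hy₀, MulAction.Quotient.smul_mk, smul_eq_mul, mul_one]
    rw [this, Pi.zero_apply, (hall g y₀).mpr hv00]

/-- **`δ` is surjective** (`n ≠ 0`): `δ(e_q ⊗ δₙ) = [q⁻¹∞]` and every cusp class is some
`[q⁻¹∞]`. [folklore] -/
theorem bdryKMap_surjective (hn0 : n ≠ 0) : Function.Surjective (bdryKMap N n) := by
  rw [← LinearMap.range_eq_top, eq_top_iff, ← (Pi.basisFun ℚ _).span_eq, Submodule.span_le]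
  rintro _ ⟨c, rfl⟩
  obtain ⟨q, rfl⟩ := cuspInfty_surjective c
  refine ⟨Pi.single q (Pi.single (Fin.last n) 1), ?_⟩
  have h0l : (0 : Fin (n + 1)) ≠ Fin.last n := by
    intro h
    have := congrArg Fin.val h
    rw [Fin.val_zero, Fin.val_last] at this
    exact hn0 this.symm
  rw [bdryKMap_single, Pi.single_eq_same, Pi.single_eq_of_ne h0l, one_smul,
    zero_smul, sub_zero, Pi.basisFun_apply]

/-- `(-1)^{n/2} = -ε₄(n + 2)` for even `n`. [folklore] -/
theorem neg_one_pow_half_eq_neg_eps4 (hn : Even n) : ((-1 : ℤ) ^ (n / 2)) = -eps4 ((n : ℤ) + 2) := by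
  obtain ⟨m, rfl⟩ := hn
  rw [show (m + m) / 2 = m by omega]
  unfold eps4
  rcases Nat.even_or_odd m with ⟨a, rfl⟩ | ⟨a, rfl⟩
  · rw [if_neg (by omega)]
    rw [show a + a = 2 * a by ring, pow_mul]
    simp
  · rw [if_pos (by omega), pow_succ, show 2 * a = 2 * a by rfl, pow_mul]
    simp

variable (N)

/-- **The rank bound for the cuspidal M-symbols: `dim_ℚ Ψ(ker δ) ≤ 2 dim_ℂ S_{n+2}(Γ₀(N))`**
(even `n ≥ 2`). Count: `dim ker δ = μ(n+1) - ν_∞` (`δ` onto), `Ψ` kills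
`Rel ⊆ ker δ` with `dim Rel = (μ(n+1) + ν₂(-1)^{n/2})/2 + (μ(n+1) + 2ν₃A(n))/3` (the two ranges meet
trivially), so `6 dim Ψ(ker δ) ≤ μ(n+1) - 3ν₂(-1)^{n/2} - 4ν₃A(n) - 6ν_∞ =
(k-1)μ + 3ν₂ε₄(k) + 4ν₃ε₆(k) - 6ν_∞ ≤ 12 dim S_k` by the dimension inequality
`le_twelve_mul_finrank_cuspForm_gamma0_of_even` — Manin's presentation of the weight-`k` modular
symbols (Shimura 1971, §8.2, Thm. 8.4: `dim H¹_P = 2 dim S_k`; Merel 1994, Thm. 2 / Prop. 4 for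
the M-symbol form) in its inequality half. [cite: Shimura1971, Thm. 8.4] -/
theorem finrank_map_ker_bdryKMap_le (hn : Even n) (hn0 : n ≠ 0) :
    Module.finrank ℚ ((LinearMap.ker (bdryKMap N n)).map (msymbKMap N n)) ≤
      2 * Module.finrank ℂ (CuspForm (Gamma0 N) (n + 2)) := by
  set V := Gamma0Coset N → Fin (n + 1) → ℚ
  set U : Submodule ℚ V := LinearMap.ker (bdryKMap N n) with hUdef
  set Ψ := msymbKMap N n
  -- `μ`, `ν₂`, `ν₃`, `ν_∞`
  have hμ : ((Gamma0 N).index : ℤ) = Fintype.card (Gamma0Coset N) := by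
    rw [Subgroup.index, Nat.card_eq_fintype_card]
  have hμ' : ((Gamma0 N).index : ℤ) = gamma0Index N := by
    exact_mod_cast index_gamma0_eq_gamma0Index_holds N
  have hν₂ : (Nat.card {q : Gamma0Coset N // S • q = q} : ℤ) = nu₂ N := by
    exact_mod_cast card_fixed_S_eq_nu₂ (N := N)
  have hν₃ : (Nat.card {q : Gamma0Coset N // (T * S) • q = q} : ℤ) = nu₃ N := by
    exact_mod_cast card_fixed_TS_eq_nu₃ (N := N)
  have hν : (Nat.card (CuspOrbits (Gamma0 N : Subgroup (GL (Fin 2) ℝ))) : ℤ) = nuInfty N := by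
    exact_mod_cast numCusps_eq_nuInfty_holds N
  -- `dim U = μ(n+1) - ν_∞`
  haveI : Fintype (CuspOrbits (Gamma0 N : Subgroup (GL (Fin 2) ℝ))) := Fintype.ofFinite _
  have hUδ : Module.finrank ℚ (LinearMap.range (bdryKMap N n)) + Module.finrank ℚ U =
      Fintype.card (Gamma0Coset N) * (n + 1) := by
    rw [LinearMap.finrank_range_add_finrank_ker, finrank_mspace]
  have hδ : Module.finrank ℚ (LinearMap.range (bdryKMap N n)) =
      Nat.card (CuspOrbits (Gamma0 N : Subgroup (GL (Fin 2) ℝ))) := by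
    rw [LinearMap.range_eq_top.mpr (bdryKMap_surjective n hn0), finrank_top,
      Module.finrank_fintype_fun_eq_card, Nat.card_eq_fintype_card]
  -- `dim Ψ(U) + dim (U ∩ ker Ψ) = dim U`, `Rel ⊆ U ∩ ker Ψ`
  set g : U →ₗ[ℚ] Module.Dual ℂ (CuspForm (Gamma0 N) (n + 2)) := Ψ.domRestrict U
  have hg : Module.finrank ℚ (LinearMap.range g) + Module.finrank ℚ (LinearMap.ker g) = Module.finrank ℚ U :=
    LinearMap.finrank_range_add_finrank_ker g
  have hrange : LinearMap.range g = U.map Ψ := LinearMap.range_domRestrict _ _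
  have hker : (relModuleK N n).comap U.subtype ≤ LinearMap.ker g := by
    intro x hx
    rw [LinearMap.mem_ker, LinearMap.domRestrict_apply]
    exact relModuleK_le_ker_msymbKMap n hn hx
  have hRel : Module.finrank ℚ (relModuleK N n) ≤ Module.finrank ℚ (LinearMap.ker g) := by
    calc Module.finrank ℚ (relModuleK N n) = Module.finrank ℚ ((relModuleK N n).comap U.subtype) :=
          (LinearEquiv.finrank_eq (Submodule.comapSubtypeEquivOfLe (relModuleK_le_ker_bdryKMap n hn))).symm
      _ ≤ Module.finrank ℚ (LinearMap.ker g) := Submodule.finrank_mono hker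
  -- `dim Rel = dim R₂ + dim R₃`
  have hRel2 : Module.finrank ℚ (relModuleK N n) =
      Module.finrank ℚ (LinearMap.range (relTwoK N n)) + Module.finrank ℚ (LinearMap.range (relThreeK N n)) := by
    have h3 := Submodule.finrank_sup_add_finrank_inf_eq (LinearMap.range (relTwoK N n))
      (LinearMap.range (relThreeK N n))
    have h4 : Module.finrank ℚ ↥(LinearMap.range (relTwoK N n) ⊓ LinearMap.range (relThreeK N n)) = 0 := by
      rw [Submodule.finrank_eq_zero, eq_bot_iff, ← fixedOpS_inf_fixedOpU_eq_bot n hn hn0]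
      exact inf_le_inf (range_relTwoK_le n hn) (range_relThreeK_le n hn)
    rw [relModuleK]
    omega
  have h2 := two_mul_finrank_range_relTwoK (N := N) n hn
  have h3 := three_mul_finrank_range_relThreeK (N := N) n hn
  -- the dimension inequality
  have hB := le_twelve_mul_finrank_cuspForm_gamma0_of_even N (k := (n : ℤ) + 2)
    (by exact_mod_cast hn.add even_two)
  have hs := neg_one_pow_half_eq_neg_eps4 n hn
  have ha := altFib_eq_neg_eps6 hn
  -- combine (in `ℚ`)
  have hfin : Module.finrank ℚ (LinearMap.range g) ≤ 2 * Module.finrank ℂ (CuspForm (Gamma0 N) (n + 2)) := by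
    have e1 : (Module.finrank ℚ (LinearMap.range g) : ℚ) + Module.finrank ℚ (LinearMap.ker g) = Module.finrank ℚ U := by
      exact_mod_cast hg
    have e2 : (Module.finrank ℚ (relModuleK N n) : ℚ) ≤ Module.finrank ℚ (LinearMap.ker g) := by exact_mod_cast hRel
    have e3 : (Module.finrank ℚ (relModuleK N n) : ℚ) =
        Module.finrank ℚ (LinearMap.range (relTwoK N n)) + Module.finrank ℚ (LinearMap.range (relThreeK N n)) := by
      exact_mod_cast hRel2
    have e4 : (Module.finrank ℚ (LinearMap.range (bdryKMap N n)) : ℚ) + Module.finrank ℚ U =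
        Fintype.card (Gamma0Coset N) * (n + 1) := by exact_mod_cast hUδ
    have e5 : (Module.finrank ℚ (LinearMap.range (bdryKMap N n)) : ℚ) = nuInfty N := by
      have : (Module.finrank ℚ (LinearMap.range (bdryKMap N n)) : ℤ) = nuInfty N := by rw [← hν]; exact_mod_cast hδ
      exact_mod_cast this
    have e6 : (Fintype.card (Gamma0Coset N) : ℚ) = gamma0Index N := by
      have : (Fintype.card (Gamma0Coset N) : ℤ) = gamma0Index N := by rw [← hμ, hμ']
      exact_mod_cast this
    have e7 : (Nat.card {q : Gamma0Coset N // S • q = q} : ℚ) = nu₂ N := by exact_mod_cast hν₂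
    have e8 : (Nat.card {q : Gamma0Coset N // (T * S) • q = q} : ℚ) = nu₃ N := by exact_mod_cast hν₃
    have e9 : ((-1 : ℚ) ^ (n / 2)) = -(eps4 ((n : ℤ) + 2) : ℚ) := by exact_mod_cast hs
    have e10 : ((altFib n : ℚ)) = -(eps6 ((n : ℤ) + 2) : ℚ) := by exact_mod_cast ha
    have e11 : (((n : ℚ) + 2 - 1) * gamma0Index N - 6 * nuInfty N + 3 * nu₂ N * eps4 ((n : ℤ) + 2) +
        4 * nu₃ N * eps6 ((n : ℤ) + 2) : ℚ) ≤
        12 * (Module.finrank ℂ (CuspForm (Gamma0 N) ((n : ℤ) + 2)) : ℚ) := by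
      exact_mod_cast hB
    set P2 : ℚ := (nu₂ N : ℚ) * (eps4 ((n : ℤ) + 2) : ℚ) with hP2
    set P3 : ℚ := (nu₃ N : ℚ) * (eps6 ((n : ℤ) + 2) : ℚ) with hP3
    rw [e6, e7, e9] at h2
    rw [e6, e8, e10] at h3
    rw [e5, e6] at e4
    have h2' : 2 * (Module.finrank ℚ (LinearMap.range (relTwoK N n)) : ℚ) =
        gamma0Index N * ((n : ℚ) + 1) - P2 := by rw [hP2]; linear_combination h2
    have h3' : 3 * (Module.finrank ℚ (LinearMap.range (relThreeK N n)) : ℚ) =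
        gamma0Index N * ((n : ℚ) + 1) - 2 * P3 := by rw [hP3]; linear_combination h3
    have e11' : ((n : ℚ) + 1) * gamma0Index N - 6 * nuInfty N + 3 * P2 + 4 * P3 ≤
        12 * (Module.finrank ℂ (CuspForm (Gamma0 N) ((n : ℤ) + 2)) : ℚ) := by
      rw [hP2, hP3]; linarith
    have : (Module.finrank ℚ (LinearMap.range g) : ℚ) ≤
        2 * (Module.finrank ℂ (CuspForm (Gamma0 N) (n + 2)) : ℚ) := by
      linarith
    exact_mod_cast this
  rw [hrange] at hfin
  exact hfin

end Count

/-! ### §6. Manin's trick in weight `k`: every `λ_{k,q}` is `Ψ` of an integral chain with boundary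
`q₁ⁿ[k∞] - (kq)₁ⁿ[∞]` -/

section Chain

open Module LinearMap
open scoped Classical

variable {N : ℕ} [NeZero N] (n : ℕ)

/-- The functional `f ↦ c_f(k)(q)` for `k ∈ SL(2, ℤ)`, `q ∈ ℤ²` (extends `periodFunctionalK` from
`Γ₀(N)` to `SL(2, ℤ)`). [folklore] -/
def periodFnDual (k : SL(2, ℤ)) (q : Fin 2 → ℤ) : Module.Dual ℂ (CuspForm (Gamma0 N) (n + 2)) where
  toFun f := periodFn n f k (fun i ↦ (q i : ℂ))
  map_add' f g := periodFn_add f g k _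
  map_smul' c f := periodFn_smul c f k _

/-- Unfolding `periodFnDual`. [folklore] -/
@[simp] theorem periodFnDual_apply (k : SL(2, ℤ)) (q : Fin 2 → ℤ) (f : CuspForm (Gamma0 N) (n + 2)) :
    periodFnDual n k q f = periodFn n f k (fun i ↦ (q i : ℂ)) := rfl

/-- `periodFnDual` extends `periodFunctionalK`. [folklore] -/
theorem periodFunctionalK_eq_periodFnDual (γ : Gamma0 N) (q : Fin 2 → ℤ) :
    periodFunctionalK n γ q = periodFnDual n (γ : SL(2, ℤ)) q := rfl

/-- The integral moment coefficients `w(p)ⱼ = C(n,j) p₁ʲ (-p₀)ⁿ⁻ʲ` of the point `p ∈ ℤ²`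
(`momPoly y p = ∑ⱼ w(p)ⱼ yⱼ`). [folklore] -/
def wvec (p : Fin 2 → ℤ) : Fin (n + 1) → ℤ := fun j ↦ (n.choose j : ℤ) * p 1 ^ (j : ℕ) * (-(p 0)) ^ (n - j)

/-- `Ψ(e_x ⊗ w(p))(f) = momPoly μ(g)(f) p` on the coset `x = g⁻¹Γ₀(N)`. [folklore] -/
theorem msymbKMap_single_wvec_apply (g : SL(2, ℤ)) (p : Fin 2 → ℤ) (f : CuspForm (Gamma0 N) (n + 2)) :
    msymbKMap N n (Pi.single ((g⁻¹ : SL(2, ℤ)) : Gamma0Coset N) (fun j ↦ (wvec n p j : ℚ))) f =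
      momPoly n (fun j ↦ msymbMoment n g j f) (fun i ↦ (p i : ℂ)) := by
  rw [msymbKMap_single, LinearMap.coe_sum, Finset.sum_apply, momPoly_apply]
  refine Finset.sum_congr rfl fun j _ ↦ ?_
  rw [LinearMap.smul_apply, msymbK_mk, inv_inv, Rat.smul_def, wvec]
  push_cast
  ring

omit [NeZero N] in
/-- `(v, -u) = S⁻¹(u, v)` over `ℤ`. [folklore] -/
theorem vec_eq_S_inv_mulVec (p : Fin 2 → ℤ) :
    (![p 1, -p 0] : Fin 2 → ℤ) = ((S⁻¹ : SL(2, ℤ)) : Matrix (Fin 2) (Fin 2) ℤ).mulVec p := by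
  funext i
  fin_cases i <;>
    simp [Matrix.mulVec, dotProduct, Fin.sum_univ_two, Matrix.SpecialLinearGroup.coe_inv,
      ModularGroup.coe_S, Matrix.adjugate_fin_two]

/-- **Manin's trick in weight `k`** (continued fractions, as a Euclidean induction on the
lower-left entry, carrying the polynomial along): for every `k ∈ SL(2, ℤ)` and `q ∈ ℤ²`, the
functional `λ_{k,q} : f ↦ c_f(k)(q)` is `Ψ(c)` for an integral chain `c ∈ 𝕄` with boundary
`δ(c) = q₁ⁿ [k∞] - (kq)₁ⁿ [∞]` — the boundary of the modular symbol `{∞, k∞} ⊗ ((zv - u) ∘ k)ⁿ`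
(values of `det(·, kq)ⁿ` at the primitive vectors `ke₁`, `e₁` of the two cusps). Step: with
`m = -⌊k₁₁/k₁₀⌋`, `k' = kTᵐS` (smaller `|k'₁₀|`), `p = T⁻ᵐq`, `q' = S⁻¹p`:
`c_f(k)(q) = c_f(k')(q') + [c_f(kTᵐ)(p) - c_f(kTᵐS)(S⁻¹p)]` (`c_f(kTᵐ)(p) = c_f(k)(Tᵐp)`,
`periodFn_mul_of_apply_one_zero`), the bracket being the M-symbol `e_{(kTᵐ)⁻¹} ⊗ w(p)`
(Manin 1972, Thm. 1.6; Merel 1994, Prop. 8 for the weight-`k` M-symbols). [cite: Manin1972, Thm. 1.6] -/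
theorem exists_chainK (hn : Even n) (k : SL(2, ℤ)) (q : Fin 2 → ℤ) :
    ∃ c : Gamma0Coset N → Fin (n + 1) → ℚ, (∀ x j, ∃ m : ℤ, c x j = m) ∧
      msymbKMap N n c = periodFnDual n k q ∧
      bdryKMap N n c = ((q 1 : ℤ) : ℚ) ^ n • Pi.single (cuspOrbitOf N k) 1 -
        ((((k : Matrix (Fin 2) (Fin 2) ℤ).mulVec q) 1 : ℤ) : ℚ) ^ n • Pi.single (cuspOrbitOf N 1) 1 := by
  suffices H : ∀ m : ℕ, ∀ (k : SL(2, ℤ)) (q : Fin 2 → ℤ), (k 1 0).natAbs = m →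
      ∃ c : Gamma0Coset N → Fin (n + 1) → ℚ, (∀ x j, ∃ m : ℤ, c x j = m) ∧
        msymbKMap N n c = periodFnDual n k q ∧
        bdryKMap N n c = ((q 1 : ℤ) : ℚ) ^ n • Pi.single (cuspOrbitOf N k) 1 -
          ((((k : Matrix (Fin 2) (Fin 2) ℤ).mulVec q) 1 : ℤ) : ℚ) ^ n •
            Pi.single (cuspOrbitOf N 1) 1 from H _ k q rfl
  intro m
  induction m using Nat.strong_induction_on with
  | _ m ih =>
    intro k q hk
    by_cases hz : k 1 0 = 0
    · -- `k∞ = ∞`: the period vanishes and so does the boundary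
      refine ⟨0, fun x j ↦ ⟨0, by simp⟩, ?_, ?_⟩
      · rw [map_zero]
        ext f
        rw [LinearMap.zero_apply, periodFnDual_apply]
        have := periodFn_mul_of_apply_one_zero n f 1 k hz (fun i ↦ (q i : ℂ))
        rw [one_mul, periodFn_one] at this
        exact this.symm
      · rw [map_zero, cuspOrbitOf_of_apply_eq_zero hz]
        have hdet := Matrix.SpecialLinearGroup.det_coe k
        rw [Matrix.det_fin_two, hz, mul_zero, sub_zero] at hdet
        have hk11 := Int.eq_one_or_neg_one_of_mul_eq_one' hdet
        have h1 : ((k : Matrix (Fin 2) (Fin 2) ℤ).mulVec q) 1 = k 1 1 * q 1 := by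
          simp [Matrix.mulVec, dotProduct, Fin.sum_univ_two, hz]
        rw [h1]
        have : ((k 1 1 * q 1 : ℤ) : ℚ) ^ n = ((q 1 : ℤ) : ℚ) ^ n := by
          rcases hk11 with ⟨-, h⟩ | ⟨-, h⟩
          · rw [h, one_mul]
          · rw [h, neg_one_mul, Int.cast_neg, hn.neg_pow]
        rw [this, sub_self]
    · -- Euclidean step
      obtain ⟨mm, hmm⟩ : ∃ mm : ℤ, mm = -(k 1 1 / k 1 0) := ⟨_, rfl⟩
      set k' : SL(2, ℤ) := k * T ^ mm * S with hk'
      have hk'10 : k' 1 0 = k 1 1 % k 1 0 := by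
        simp only [hk', Matrix.SpecialLinearGroup.coe_mul, ModularGroup.coe_S, ModularGroup.coe_T_zpow,
          Matrix.mul_apply, Fin.sum_univ_two]
        simp [hmm, Int.emod_def]
        ring
      have hlt : (k' 1 0).natAbs < m := by
        rw [← hk, hk'10]
        have h0 := Int.emod_nonneg (k 1 1) hz
        have h1 := Int.emod_lt_abs (k 1 1) hz
        zify
        rw [abs_of_nonneg h0]
        exact h1
      -- the transported vectors
      set p : Fin 2 → ℤ := ((T ^ (-mm) : SL(2, ℤ)) : Matrix (Fin 2) (Fin 2) ℤ).mulVec q with hp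
      set q' : Fin 2 → ℤ := ![p 1, -p 0] with hq'
      have hp1 : p 1 = q 1 := by
        simp [hp, ModularGroup.coe_T_zpow, dotProduct, Fin.sum_univ_two]
      have hkq : (k' : Matrix (Fin 2) (Fin 2) ℤ).mulVec q' = (k : Matrix (Fin 2) (Fin 2) ℤ).mulVec q := by
        rw [hq', vec_eq_S_inv_mulVec, hp, Matrix.mulVec_mulVec, Matrix.mulVec_mulVec,
          ← Matrix.SpecialLinearGroup.coe_mul, ← Matrix.SpecialLinearGroup.coe_mul, hk']
        congr 2
        rw [zpow_neg]
        group
      obtain ⟨c', hc'int, hc'm, hc'b⟩ := ih _ hlt k' q' rfl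
      set g : SL(2, ℤ) := k * T ^ mm with hg
      set x₀ : Gamma0Coset N := ((g⁻¹ : SL(2, ℤ)) : Gamma0Coset N) with hx₀
      refine ⟨c' + Pi.single x₀ (fun j ↦ (wvec n p j : ℚ)), ?_, ?_, ?_⟩
      · intro x j
        obtain ⟨m', hm'⟩ := hc'int x j
        by_cases hx : x = x₀
        · subst hx
          exact ⟨m' + wvec n p j, by simp [hm']⟩
        · exact ⟨m', by simp [Pi.single_eq_of_ne hx, hm']⟩
      · rw [map_add, hc'm]
        ext f
        rw [LinearMap.add_apply, periodFnDual_apply, periodFnDual_apply, hx₀,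
          msymbKMap_single_wvec_apply, momPoly_msymbMoment]
        have e1 : periodFn n f g (fun i ↦ (p i : ℂ)) = periodFn n f k (fun i ↦ (q i : ℂ)) := by
          rw [hg, periodFn_mul_of_apply_one_zero n f k (T ^ mm)
            (by simp [ModularGroup.coe_T_zpow]), icmat_mulVec_intCast]
          congr 1
          funext i
          rw [hp, Matrix.mulVec_mulVec, ← Matrix.SpecialLinearGroup.coe_mul, zpow_neg, mul_inv_cancel,
            Matrix.SpecialLinearGroup.coe_one, Matrix.one_mulVec]
        have e2 : periodFn n f (g * S) ![((fun i ↦ (p i : ℂ)) : Fin 2 → ℂ) 1, -((fun i ↦ (p i : ℂ)) 0)] =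
            periodFn n f k' (fun i ↦ (q' i : ℂ)) := by
          have hgS : g * S = k' := by rw [hg, hk']
          rw [hgS]
          congr 1
          funext i
          fin_cases i <;> simp [hq']
        rw [e1, e2]
        ring
      · rw [map_add, hc'b, bdryKMap_single]
        have c1 : cuspInfty N x₀ = cuspOrbitOf N k := by
          rw [hx₀, cuspInfty_mk, inv_inv, hg, cuspOrbitOf_mul_T_zpow]
        have c2 : cuspInfty N (S⁻¹ • x₀) = cuspOrbitOf N k' := by
          rw [hx₀, MulAction.Quotient.smul_mk, smul_eq_mul, cuspInfty_mk, mul_inv_rev, inv_inv, inv_inv,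
            hg, hk']
        rw [c1, c2]
        have hw_last : ((wvec n p (Fin.last n) : ℤ) : ℚ) = ((q 1 : ℤ) : ℚ) ^ n := by
          simp [wvec, hp1]
        have hw_zero : ((wvec n p 0 : ℤ) : ℚ) = ((p 0 : ℤ) : ℚ) ^ n := by
          simp [wvec, hn.neg_pow]
        have hq'1 : ((q' 1 : ℤ) : ℚ) ^ n = ((p 0 : ℤ) : ℚ) ^ n := by
          simp [hq', hn.neg_pow]
        rw [hw_last, hw_zero, hq'1, hkq]
        abel

/-- **Period functionals of `Γ₀(N)` are images of chains with boundary at `[∞]` only**: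
`λ_{γ,q} = Ψ(c)` with `δ(c) = (q₁ⁿ - (γq)₁ⁿ)[∞]` — the coefficient `q₁ⁿ - (γq)₁ⁿ` is the
coboundary `∂(γ, q)` of `q ↦ q₁ⁿ` (the weight-`k` trace of the Eisenstein class at `∞`). [folklore] -/
theorem exists_chainK_gamma0 (hn : Even n) (γ : Gamma0 N) (q : Fin 2 → ℤ) :
    ∃ c : Gamma0Coset N → Fin (n + 1) → ℚ, (∀ x j, ∃ m : ℤ, c x j = m) ∧
      msymbKMap N n c = periodFunctionalK n γ q ∧
      bdryKMap N n c = ((((q 1 : ℤ) : ℚ) ^ n -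
        (((((γ : SL(2, ℤ)) : Matrix (Fin 2) (Fin 2) ℤ).mulVec q) 1 : ℤ) : ℚ) ^ n)) •
          Pi.single (cuspOrbitOf N 1) 1 := by
  obtain ⟨c, hint, hm, hb⟩ := exists_chainK (N := N) n hn (γ : SL(2, ℤ)) q
  refine ⟨c, hint, hm, ?_⟩
  have hγ : cuspOrbitOf N (γ : SL(2, ℤ)) = cuspOrbitOf N 1 := by
    simpa using cuspOrbitOf_mul_of_mem γ.2 (1 : SL(2, ℤ))
  rw [hb, hγ, sub_smul]

end Chain

/-! ### §7. The cuspidal sublattice `C ⊆ periodLatticeK` and its rank bound `dim_ℚ ℚC ≤ 2 dim_ℂ S_k` -/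

section CuspidalLattice

open Module LinearMap
open scoped Classical

variable {N : ℕ} [NeZero N] (n : ℕ)

/-- **The boundary of a generator**: `∂(γ, q) = q₁ⁿ - (γq)₁ⁿ` — the coefficient of `[∞]` in the
boundary of the modular symbol `{∞, γ∞} ⊗ det(·, γq)ⁿ` underlying `λ_{γ,q}`
(`exists_chainK_gamma0`); as a function of `γ` it is the coboundary of `q ↦ q₁ⁿ`. [folklore] -/
def bdryInt (gq : Gamma0 N × (Fin 2 → ℤ)) : ℤ :=
  gq.2 1 ^ n - (((gq.1 : SL(2, ℤ)) : Matrix (Fin 2) (Fin 2) ℤ).mulVec gq.2 1) ^ n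

/-- The realisation map `ℤ^{(Γ₀(N) × ℤ²)} → S^∨`, `∑ a_{γ,q}(γ, q) ↦ ∑ a_{γ,q} λ_{γ,q}`. [folklore] -/
def genMap : ((Gamma0 N × (Fin 2 → ℤ)) →₀ ℤ) →+ Module.Dual ℂ (CuspForm (Gamma0 N) (n + 2)) :=
  Finsupp.liftAddHom fun gq ↦ zmultiplesHom _ (periodFunctionalK n gq.1 gq.2)

/-- The total boundary `ℤ^{(Γ₀(N) × ℤ²)} → ℤ`, `∑ a_{γ,q}(γ, q) ↦ ∑ a_{γ,q} ∂(γ, q)`. [folklore] -/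
def bdryF : ((Gamma0 N × (Fin 2 → ℤ)) →₀ ℤ) →+ ℤ :=
  Finsupp.liftAddHom fun gq ↦ zmultiplesHom _ (bdryInt n gq)

/-- **The cuspidal period lattice** `C ⊆ S_{n+2}(Γ₀(N))^∨`: the functionals `∑ a_{γ,q} λ_{γ,q}` of
the integral combinations with total boundary `∑ a_{γ,q} ∂(γ, q) = 0` (the periods of the
*cuspidal* integral modular symbols supported on `Γ₀(N)`-loops at `∞`). [folklore] -/
def cuspidalLatticeK : AddSubgroup (Module.Dual ℂ (CuspForm (Gamma0 N) (n + 2))) :=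
  (bdryF n (N := N)).ker.map (genMap n)

/-- `genMap` on a formal combination. [folklore] -/
theorem genMap_apply (x : (Gamma0 N × (Fin 2 → ℤ)) →₀ ℤ) :
    genMap n x = x.sum fun gq a ↦ a • periodFunctionalK n gq.1 gq.2 := by
  simp only [genMap, Finsupp.liftAddHom_apply, Finsupp.sum, zmultiplesHom_apply]

omit [NeZero N] in
/-- `bdryF` on a formal combination. [folklore] -/
theorem bdryF_apply (x : (Gamma0 N × (Fin 2 → ℤ)) →₀ ℤ) :
    bdryF n x = x.sum fun gq a ↦ a * bdryInt n gq := by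
  simp only [bdryF, Finsupp.liftAddHom_apply, Finsupp.sum, zmultiplesHom_apply, smul_eq_mul]

/-- `genMap` of a generator is `λ_{γ,q}`. [folklore] -/
@[simp] theorem genMap_single (gq : Gamma0 N × (Fin 2 → ℤ)) (a : ℤ) :
    genMap n (Finsupp.single gq a) = a • periodFunctionalK n gq.1 gq.2 := by
  simp [genMap]

omit [NeZero N] in
/-- `bdryF` of a generator is `a ∂(γ, q)`. [folklore] -/
@[simp] theorem bdryF_single (gq : Gamma0 N × (Fin 2 → ℤ)) (a : ℤ) :
    bdryF n (Finsupp.single gq a) = a * bdryInt n gq := by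
  simp [bdryF]

/-- `C ⊆ periodLatticeK`. [folklore] -/
theorem cuspidalLatticeK_le_periodLatticeK : cuspidalLatticeK (N := N) n ≤ periodLatticeK n := by
  rintro _ ⟨x, -, rfl⟩
  rw [genMap_apply, Finsupp.sum]
  exact AddSubgroup.sum_mem _ fun gq _ ↦ AddSubgroup.zsmul_mem _ (periodFunctionalK_mem _ _) _

/-- **The cuspidal lattice lies in the image of the cuspidal M-symbols: `C ⊆ Ψ(ker δ)`** (even `n`):
write each `λ_{γ,q} = Ψ(c_{γ,q})` with `δ(c_{γ,q}) = ∂(γ, q)[∞]` (`exists_chainK_gamma0`); a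
combination with total boundary `0` is then `Ψ` of a cycle. [folklore] -/
theorem cuspidalLatticeK_subset_map_ker (hn : Even n) :
    (cuspidalLatticeK (N := N) n : Set (Module.Dual ℂ (CuspForm (Gamma0 N) (n + 2)))) ⊆
      (LinearMap.ker (bdryKMap N n)).map (msymbKMap N n) := by
  choose ch _ hΨ hδ using fun gq : Gamma0 N × (Fin 2 → ℤ) ↦ exists_chainK_gamma0 (N := N) n hn gq.1 gq.2
  rintro _ ⟨x, hx, rfl⟩
  have hx0 : bdryF n x = 0 := hx
  refine ⟨x.sum fun gq a ↦ (a : ℚ) • ch gq, ?_, ?_⟩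
  · rw [SetLike.mem_coe, LinearMap.mem_ker, Finsupp.sum, map_sum]
    simp only [map_smul, hδ, smul_smul]
    rw [← Finset.sum_smul]
    have : ∑ gq ∈ x.support, (x gq : ℚ) * (((gq.2 1 : ℤ) : ℚ) ^ n -
        (((((gq.1 : SL(2, ℤ)) : Matrix (Fin 2) (Fin 2) ℤ).mulVec gq.2) 1 : ℤ) : ℚ) ^ n) =
        ((bdryF n x : ℤ) : ℚ) := by
      rw [bdryF_apply, Finsupp.sum]
      push_cast
      refine Finset.sum_congr rfl fun gq _ ↦ ?_
      simp [bdryInt]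
    rw [this, hx0, Int.cast_zero, zero_smul]
  · rw [genMap_apply, Finsupp.sum, Finsupp.sum, map_sum]
    refine Finset.sum_congr rfl fun gq _ ↦ ?_
    rw [map_smul, hΨ, Int.cast_smul_eq_zsmul]

/-- The `ℚ`-span of the cuspidal lattice is finite-dimensional. [folklore] -/
theorem finite_span_cuspidalLatticeK (hn : Even n) :
    Module.Finite ℚ (Submodule.span ℚ (cuspidalLatticeK (N := N) n :
      Set (Module.Dual ℂ (CuspForm (Gamma0 N) (n + 2))))) :=
  Submodule.finiteDimensional_of_le (Submodule.span_le.mpr (cuspidalLatticeK_subset_map_ker n hn))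

/-- **The rank bound for the cuspidal lattice: `dim_ℚ ℚC ≤ 2 dim_ℂ S_{n+2}(Γ₀(N))`** (even
`n ≥ 2`): `ℚC ⊆ Ψ(ker δ)` and `dim Ψ(ker δ) ≤ 2 dim S_{n+2}` (`finrank_map_ker_bdryKMap_le`) — the
rank half of the lattice property of the Eichler–Shimura periods (Shimura 1971, Thm. 8.4 with
Prop. 8.6: `rank H¹_P(Γ, ℤ^{n+1}) = 2 dim S_k`), here for `Γ₀(N)` in its inequality form. [cite: Shimura1971, Thm. 8.4 and Prop. 8.6] -/
theorem finrank_span_cuspidalLatticeK_le (hn : Even n) (hn0 : n ≠ 0) :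
    Module.finrank ℚ (Submodule.span ℚ (cuspidalLatticeK (N := N) n :
      Set (Module.Dual ℂ (CuspForm (Gamma0 N) (n + 2))))) ≤
      2 * Module.finrank ℂ (CuspForm (Gamma0 N) (n + 2)) := by
  haveI := finite_span_cuspidalLatticeK (N := N) n hn
  exact (Submodule.finrank_mono (Submodule.span_le.mpr (cuspidalLatticeK_subset_map_ker n hn))).trans
    (finrank_map_ker_bdryKMap_le N n hn hn0)

end CuspidalLattice

end Literature.NumberTheory.EllipticCurves.ModularForms
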